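import Literature.MathematicalPhysics.QuantumFieldTheory.Balaban1983to89.Node00.OpsYSectDESymm
import Literature.MathematicalPhysics.QuantumFieldTheory.Balaban1983to89.Node00.OpsYSectEElim
import Literature.MathematicalPhysics.QuantumFieldTheory.Balaban1983to89.B9Eq3117Current
import Literature.MathematicalPhysics.QuantumFieldTheory.Balaban1983to89.B9Eq310Hermitian

/-!
# `Balaban1983to89.Node00.OpsYDelta2Form` — [B9] (3.134): the residual letter `Δ⁽²⁾(U)` of def-Y's record AS A FUNCTION of [5]'s second-order
# averaging form `C⁽²⁾` (the operator of the quadratic form `A ↦ 2⟨HC⁽²⁾(A), J⟩`, `J = D*η⁻²Im ∂U`), and the v7 instance of record `opsYOfRecordV7E`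

T. Bałaban, *Propagators for lattice gauge theories in a background field*, Commun. Math. Phys. **99** (1985) 389–434
[`Balaban1985BackgroundPropagators`, "B9"]; [5] = T. Bałaban, *Averaging operations for lattice gauge theories*, Commun. Math. Phys. **98** (1985) 17–51
[`Balaban1985Averaging`, "B7"]; T. Bałaban, *The variational problem and background fields in renormalization group method for lattice gauge
theories*, Commun. Math. Phys. **102** (1985) 277–309 [`Balaban1985Variational`, "B11"] for the polarised notation `C⁽²⁾(A′, A″)` (p. 286 after (56):
*"C_j⁽²⁾(A′, A″) denotes a symmetric bilinear form obtained by polarization from the quadratic form C⁽²⁾(A′)"*).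

statement-level skeleton of published theorems with citation tags; proofs where landed; nothing here is a claim about the
Yang–Mills mass gap

THE PRINTED LOCI (p. 422 read from the page image; v1.1: quotations re-checked against the page owner's renders, lit-balaban-r06 QUOTATION CHECKS #2∕#3).
(3.134): *"Let us define ⟨A, Δ⁽²⁾A⟩ = 2⟨HC⁽²⁾(A), J⟩."* — the definitional force is «Let us define» itself (the sentence that follows, *"A meaning of
Δ_π⁽²⁾ is obvious, it defines the second quadratic form in (3.128), i.e. we have Δ_π⁽²⁾ = Δ⁽²⁾ − DRG′D\*Δ⁽²⁾ − Δ⁽²⁾DG′RD\* + DRG′D\*Δ⁽²⁾DG′RD\*. (3.135)"*,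
glosses (3.135)'s `Δ_π⁽²⁾` — subscript `π`, dropped by the text layer — and is OUTSIDE this file's scope); (3.136): *"To find bounds for the operator Δ⁽²⁾ let
us write it in the form Δ⁽²⁾A = Σ_{j=1}^{k} Σ_{b∈Λ_j} (L^jη)^{d+1} tr (δ∕δA) C_j⁽²⁾(A, b)(H\*J)(b)"*; p. 419, two separate sentences: *"Expanding the both
sides of the identity according to (3.12), and comparing terms of the same order, we get the identities ⟨Dλ, J⟩ = 0, or D\*J = 0"* and, after (3.117), *"the
error terms are small because the function J = D\*η⁻²Im ∂U is small, if U satisfies the condition (3.36)"* («C⁽²⁾ is of second order» is p. 421 after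
(3.127): *"a second order term in the expansion of Q_j(ηA)"*, and p. 393 after (3.14): *"whose expansion begins with second order terms"*); p. 392, (3.11):
*"where J = D\*η⁻²Im ∂U, (∂U)(p) = U(∂p)"* with the bond pairing `⟨A, J⟩ = Σ_{b⊂T_η} η^d tr A(b)J(b)`; p. 420, (3.126): *"HB = GQ\*(QGQ\*)⁻¹B"* with a
PLAIN `G` that print re-defines two lines lower — written `G̃` below (the N06 lineage's disambiguator `Gt` ∕ `GDY`, not print's glyph).

WHY THIS FILE (def-Y's located gap (O3) of `OPS-LETTERS-CONSTRUCTION.md` §8).  In the record `opsYOfRecordV6E N θ M⋆ 𝔯 𝔢₀ 𝔴 𝔈` the residual operator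
layer `𝔯 : ResY N θ M⋆` — one bond-sector letter `Δ⁽²⁾(U)` per member with only its `U = 1` clause typed (`Node00.OpsYSectDE.ResLettersY`) — is a bare
PARAMETER, *«its lattice construction needs [5]'s C⁽²⁾ and the field J, which are not objects of NODE 00's tree»*.  Half of that is no longer true:
r06's `B9Eq39Adjoint.J` ((3.11), with `B9Eq3117Current.divB_J_eq_zero` = (3.117) and `J_gaugeTr`) IS in the tree on exactly the abstract torus
model `(S, T, ι)` that NODE 00's carriers instantiate (`CfgY 𝔸 i = CfgV1 (PV …) 𝔸`, shifts `shiftsV1`), and def-Y's `H` of (3.126) is `HDY`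
(`B9Eq3132SectDLetters`, dag-n06-i) over def-Y's tables of record.  So (3.134) can be TYPED AS PRINTED: `Δ⁽²⁾(U)` is *the operator of a quadratic
form*, i.e. a definite FUNCTION of the one genuinely external letter, [5]'s second-order averaging form `C⁽²⁾`.  This file does that, proves the
defining identity, its uniqueness, (3.136)'s `H\*` form, the `U = 1` clause (now a theorem: `∂U = 1 ⇒ Im ∂U = 0 ⇒ J = 0`), trace-symmetry, —
at unitary `U`, for real `C⁽²⁾`, `H` — the Hermitian symmetry `IsSymmTr 1 (Δ⁽²⁾(U))` that `Node00.OpsYSectDESymm` (gen 8) had to DISPLAY as `hΔ2`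
for the parameter `𝔯`, and — for a covariant `C⁽²⁾` — the gauge covariance (3.34) `Δ⁽²⁾(U^u)R(u) = R(u)Δ⁽²⁾(U)` that `Node00.OpsYRecordV4`'s
`lettersYOfRecordV4_cov` had to DISPLAY as `hΔ` (from r06's (3.30) `J^u = R(u)J` and def-Y's `HDY_cov`); and it re-issues the instance of record with `𝔯 := resYOfC2 𝔠` (`opsYOfRecordV7E`), shrinking the record's residual
parameter from «an operator family with a `U = 1` clause» to «[5]'s `C⁽²⁾`» (flat witness `c2Y_flat`; intended instance: the second derivative of
`B7Eq136SecondOrder.CCovIter2` read level by level through a periodic chart of the member's torus — NOT constructed here).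

MODEL ∕ DICTIONARY.  (D1) PAIRINGS are the BILINEAR trace pairings `⟨Φ, Ψ⟩_τ = Σ_x τ(Φ(x)Ψ(x))` (`trPairY`; `τ = tr` at the record), print's
`Σ_b η^d tr A(b)B(b)` ∕ `Σ_{b∈Λ_j}(L^jη)^{d+1} tr …` with the (constant per sector) weights dropped exactly as in `Node00.OpsYDeltaA` (M4) and
`Node00.OpsYSectDESymm`; «the operator of a quadratic form» needs a dualising map, carried by the structure `TrDualY` (tracial `τ`, `ρ` with
`τ(a·ρ(f)) = f(a)`, separation) whose instance of record is `M_N(ℂ)` with the matrix trace (`trDualMatY`: `ρ(f)_{pq} = f(E_{qp})`).  (D2) `J(U)` is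
r06's `B9Eq39Adjoint.J (shiftsV1 (PV …)) U η` at `η = |c_f|⁻¹` of the index, read as a fine-bond function (`JY`).  (D3) `C⁽²⁾` is a LETTER:
`C2LettersY 𝔸 i = {form : U ↦ (A, A′) ↦ C⁽²⁾(U; A, A′) bilinear, symmetric}` valued in coarse-bond functions (`IBondY i → 𝔸`, the domain of `H`).
(D4) `Δ⁽²⁾(U)A := 2·ρ_X(A′ ↦ ⟨H(U)C⁽²⁾(U; A, A′), J(U)⟩_τ)` (`delta2OfY`), so that `⟨A′, Δ⁽²⁾(U)A⟩_τ = 2⟨H(U)C⁽²⁾(U; A, A′), J(U)⟩_τ` — (3.134)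
polarised; at `A′ = A` it is (3.134) verbatim, and moving `H` across the pairing by the `τ`-transpose `H†` (`trAdjY`) it is (3.136)'s «(H\*J)(b)» form.
(D5) Hermitian symmetry (`B9Thm311ReadingCoords.IsSymmTr`, the currency of def-Y's ∕ N06's consumers) follows from `τ`-symmetry plus REALITY
(`T(Φ⋆) = (TΦ)⋆`); reality of `Δ⁽²⁾(U)` follows from reality of `C⁽²⁾(U)`, of `H(U)` (displayed) and `J(U)⋆ = J(U)` (PROVED at unitary `U`: «Im» is
self-adjoint, `D\*` and `η` are real).

WHAT IS DEFINED ∕ PROVED (0 sorry; every def has a printed locus or is dictionary (D1)–(D5)).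
* §0 `trPairY` (+ `trPairBY`, add∕smul∕comm∕zero∕single lemmas), `TrDualY`, ★ `trDualMatY`, the dualising map `rieszY` with ★ `trPairY_rieszY`
  (`⟨Φ, ρ_X F⟩ = F Φ`), `trPairY_left_ext` (separation), `eq_rieszY_of_trPairY`, the `τ`-transpose `trAdjY` with `trPairY_trAdjY`.
* §1 `etaBY`, ★ `JY` ((3.11)∕(3.117) BY NAME), `JY_one` ∕ `JY_one'` (`J(1) = 0`), `shiftsV1_comm`, ★ `divB_JY_eq_zero` ((3.117) `D\*J = 0` at NODE 00).
* §2 `C2LettersY` (+ `c2LettersY_flat`).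
* §3 ★★ `delta2OfY`; ★★ `trPairY_delta2OfY` ((3.134) polarised ∕ (3.136)), ★★★ `trPairY_delta2OfY_self` ((3.134) verbatim), `trPairY_delta2OfY_trAdj`
  ((3.136) with `H†`), `trPairY_delta2OfY_symm` ∕ `…_symm'` (`τ`-symmetry), `trPairY_polarize`, ★★ `delta2OfY_unique` ((3.134) DEFINES `Δ⁽²⁾`),
  ★ `delta2OfY_one` (`Δ⁽²⁾(1) = 0`, a theorem), `delta2OfY_flat`.
* §4 ★★ `res134OfC2Y 𝔡 x 𝔠 : ResLettersY 𝔸 x` (at the record's `H = HDY parSymY parBY (GpY parSymY)`, `covLettersY_v4_H`), `C2Y` ∕ `c2Y_flat`,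
  ★★ `resYOfC2 N θ M⋆ 𝔠 : ResY N θ M⋆`, ★★★ `opsYOfRecordV7E N θ M⋆ 𝔠 𝔢₀ 𝔴 𝔈 := opsYOfRecordV6E N θ M⋆ (resYOfC2 N θ M⋆ 𝔠) 𝔢₀ 𝔴 𝔈` (+ `_eq`,
  `_eq_V4E`: every v6∕v4 face applies verbatim), `resYOfC2_Δ2`, ★★★ `sum_trace_resYOfC2_Δ2` ((3.134) at the record in matrix traces),
  `sum_trace_resYOfC2_Δ2_symm`, `resYOfC2_flat_Δ2`.
* §5 `isSymmTr_of_trSymm_of_real` (τ-symmetric + real ⇒ `IsSymmTr 1`), `resYOfC2_Δ2_isSymmTr_of_star`.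
* §6 reality: ★ `star_J` (r06's `J` is self-adjoint at a unitary background, generic `(S, T, ι)`; pv27's `B9Eq310Hermitian.star_divP ∕
  plaqU_unitary ∕ star_eta_inv` and `B9Eq37Insertion.star_imC` BY NAME — nothing of §Hermitian there restated), `star_JY`, `star_eq_inv_of_mem_unitaryUnits`, `trPairY_star`, ★★ `delta2OfY_star` ∕ `delta2OfY_star_of_unitary`,
  `trDualMatY_τ_star`, ★★ `resYOfC2_Δ2_star`, ★★★ `resYOfC2_Δ2_isSymmTr` — gen 8's displayed `hΔ2` DISCHARGED for `𝔯 := resYOfC2 𝔠` at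
  unitary-valued `U`, modulo the displayed reality of `C⁽²⁾(U)` and `H(U)`.
* §7 ★★★ `lettersYOfRecordV4_symmDG₁GG_ofC2`: the N06 certificate's `hsymD` (`GD ∧ G₁ ∧ GG` symmetric at `SU(N)`-valued `U`, edition 8) at the v4
  record over `𝔯 := resYOfC2 𝔠`, from reality of `C⁽²⁾`, `H` alone; `opsYOfRecordV7E_letters`.
* §8 GAUGE COVARIANCE (3.34) of the residual letter: `TrDualY.τ_R` (`τ(uau⁻¹) = τ(a)`), `trPairY_conjY` (`⟨R(u)Φ, R(u)Ψ⟩ = ⟨Φ, Ψ⟩`),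
  `conjY_conjY_inv`, `trPairY_conjY_left`, ★ `conjY_rieszY_comp_conjY` (the dualising map is `R(u)`-equivariant), `gaugeY_eq_gaugeTr` (def-Y's `U^u`
  IS r06's `gaugeTr` on the torus model, `rfl`), ★ `JY_gaugeY` ((3.30) `J^u = R(u)J` at NODE 00, r06's `J_gaugeTr` BY NAME), ★★ `delta2OfY_cov` ∕
  `delta2OfY_isCovBondOpY`: `Δ⁽²⁾(U^u)R(u) = R(u)Δ⁽²⁾(U)` at ANY tables from the covariance of `H` and of the form `C⁽²⁾` (both displayed there).
* §9 at the record: `C2LettersY.IsCov` ∕ `C2Y.IsCov` (covariance of the form letter, [5] (52)), `c2LettersY_flat_isCov` ∕ `c2Y_flat_isCov`,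
  ★★ `res134OfC2Y_Δ2_isCovBondOpY` (`H`'s covariance DISCHARGED by def-Y's `HDY_cov` at the tables of record), ★★ `resYOfC2_Δ2_isCovBondOpY`,
  ★★★ `lettersYOfRecordV4_cov_ofC2` — def-Y's `lettersYOfRecordV4_cov` (all eight Sect. D∕E letters covariant) with its displayed `hΔ` DISCHARGED at
  `𝔯 := resYOfC2 𝔠` for a covariant `𝔠`.

HONEST SCOPE.  Exact finite-dimensional trace algebra: (3.134) as a DEFINITION by a quadratic form and its immediate consequences; NO inequality of the
paper ((3.137) and the bounds on `H\*J` stay N06's), no positivity of `G₁`, no claim that [5]'s `C⁽²⁾` has been constructed on NODE 00's carriers (it is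
the letter `𝔠`, flat witness only), no identification of def-Y's own `coCurlY ∘ imHolY` with r06's `J` (r06's `J` is taken BY NAME), gauge covariance
of `Δ⁽²⁾(U)` proved only MODULO the displayed covariance of the form letter `C⁽²⁾` (`C2LettersY.IsCov`, a property of [5]'s construction, not
proved here), reality of `H(U)` displayed not proved.  Prior art cited, not restated: p10 `B9Delta2Def134` ∕ r06 `B9Eq3134MatrixConcrete` (matrix-carrier readings of (3.134)), an4
`Beta.RemainderDelta2TorusForm` (an `∃Δ⁽²⁾` on NE9's carriers), p06 `B7Eq136SecondOrder` ([5]'s `C⁽²⁾` engine).  NOT a node discharge, NOT summit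
progress; count-neutral; nothing continuum, nothing about reflection positivity or the mass gap.  Cell `pub-ymgap` (HUMAN RULING D-0062), Track A
NODE 00 definer row def-Y (successor gen 9), 2026-08-27.  v1.1 (same day): DOCSTRING-ONLY quotation fixes after the [B9] page owner's checks #2∕#3
(Q1 p.419's two sentences quoted separately, «second order» → p.421∕p.393; Q2 the (3.135) gloss carries its `π`; Q3 (3.11)'s `η⁻²Im` restored; Q4 no `2`
inside (3.136)'s guillemets; N1 print's plain `G` in (3.126); N2 `J(1) = 0` as an inference, not a quotation; the normalised-trace clause) — no statement,
body or name touched.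
-/

noncomputable section

namespace Literature.MathematicalPhysics.QuantumFieldTheory.Balaban1983to89.Node00

open B6KLevelCensusIndexV1 (KIdx)
open B9PinMembersKLevelV1 (MemberY)
open B6GlobalChartV1 (PV domT)
open B9BackgroundsKLevelV1 (CfgV1 shiftsV1)
open B9Thm311ReadingCoords (trIP IsSymmTr)
open B9Eq3132SectDLetters (HDY GDY)
open scoped Matrix
open scoped Matrix.Norms.L2Operator

/-! ## §0 The bilinear trace pairing on `𝔸`-valued lattice functions, trace-dual fibres, the dualising map and the `τ`-transpose -/

section TraceDual

variable {𝔸 : Type} [NormedRing 𝔸] [NormedAlgebra ℂ 𝔸] [CompleteSpace 𝔸]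
variable {X Y : Type} [Fintype X] [Fintype Y]

/-- **the BILINEAR trace pairing** `⟨Φ, Ψ⟩_τ = Σ_x τ(Φ(x)Ψ(x))` of `𝔸`-valued lattice functions, `τ` in the rôle of «tr» (print's `⟨A, B⟩ =
Σ_b η^d tr A(b)B(b)` of (3.11) with the common weight dropped, as in `Node00.OpsYDeltaA` (M4)). [cite: Balaban1985BackgroundPropagators, (3.11) p.392, dictionary] -/
def trPairY (τ : 𝔸 →ₗ[ℂ] ℂ) (Φ Ψ : X → 𝔸) : ℂ := ∑ x, τ (Φ x * Ψ x)

omit [CompleteSpace 𝔸] in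
/-- the pairing, unfolded. [cite: Balaban1985BackgroundPropagators, (3.11) p.392, bookkeeping] -/
theorem trPairY_def (τ : 𝔸 →ₗ[ℂ] ℂ) (Φ Ψ : X → 𝔸) : trPairY τ Φ Ψ = ∑ x, τ (Φ x * Ψ x) := rfl

omit [CompleteSpace 𝔸] in
/-- the pairing is additive on the left. [cite: Balaban1985BackgroundPropagators, (3.11) p.392, bookkeeping] -/
theorem trPairY_add_left (τ : 𝔸 →ₗ[ℂ] ℂ) (Φ Φ' Ψ : X → 𝔸) : trPairY τ (Φ + Φ') Ψ = trPairY τ Φ Ψ + trPairY τ Φ' Ψ := by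
  simp only [trPairY, Pi.add_apply, add_mul, map_add, Finset.sum_add_distrib]

omit [CompleteSpace 𝔸] in
/-- the pairing is homogeneous on the left. [cite: Balaban1985BackgroundPropagators, (3.11) p.392, bookkeeping] -/
theorem trPairY_smul_left (τ : 𝔸 →ₗ[ℂ] ℂ) (c : ℂ) (Φ Ψ : X → 𝔸) : trPairY τ (c • Φ) Ψ = c * trPairY τ Φ Ψ := by
  simp only [trPairY, Pi.smul_apply, smul_mul_assoc, map_smul, smul_eq_mul, Finset.mul_sum]

omit [CompleteSpace 𝔸] in
/-- the pairing is additive on the right. [cite: Balaban1985BackgroundPropagators, (3.11) p.392, bookkeeping] -/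
theorem trPairY_add_right (τ : 𝔸 →ₗ[ℂ] ℂ) (Φ Ψ Ψ' : X → 𝔸) : trPairY τ Φ (Ψ + Ψ') = trPairY τ Φ Ψ + trPairY τ Φ Ψ' := by
  simp only [trPairY, Pi.add_apply, mul_add, map_add, Finset.sum_add_distrib]

omit [CompleteSpace 𝔸] in
/-- the pairing is homogeneous on the right. [cite: Balaban1985BackgroundPropagators, (3.11) p.392, bookkeeping] -/
theorem trPairY_smul_right (τ : 𝔸 →ₗ[ℂ] ℂ) (c : ℂ) (Φ Ψ : X → 𝔸) : trPairY τ Φ (c • Ψ) = c * trPairY τ Φ Ψ := by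
  simp only [trPairY, Pi.smul_apply, mul_smul_comm, map_smul, smul_eq_mul, Finset.mul_sum]

omit [CompleteSpace 𝔸] in
/-- for a TRACIAL `τ` the pairing is symmetric. [cite: Balaban1985BackgroundPropagators, (3.11) p.392, bookkeeping] -/
theorem trPairY_comm (τ : 𝔸 →ₗ[ℂ] ℂ) (hτ : ∀ a b : 𝔸, τ (a * b) = τ (b * a)) (Φ Ψ : X → 𝔸) : trPairY τ Φ Ψ = trPairY τ Ψ Φ := by
  simp only [trPairY, hτ]

omit [CompleteSpace 𝔸] in
/-- pairing with `0` on the right. [cite: Balaban1985BackgroundPropagators, (3.11) p.392, bookkeeping] -/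
@[simp] theorem trPairY_zero_right (τ : 𝔸 →ₗ[ℂ] ℂ) (Φ : X → 𝔸) : trPairY τ Φ 0 = 0 := by
  simp only [trPairY, Pi.zero_apply, mul_zero, map_zero, Finset.sum_const_zero]

omit [CompleteSpace 𝔸] in
/-- pairing with `0` on the left. [cite: Balaban1985BackgroundPropagators, (3.11) p.392, bookkeeping] -/
@[simp] theorem trPairY_zero_left (τ : 𝔸 →ₗ[ℂ] ℂ) (Ψ : X → 𝔸) : trPairY τ 0 Ψ = 0 := by
  simp only [trPairY, Pi.zero_apply, zero_mul, map_zero, Finset.sum_const_zero]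

/-- the pairing as a `ℂ`-bilinear map. [cite: Balaban1985BackgroundPropagators, (3.11) p.392, bookkeeping] -/
def trPairBY (τ : 𝔸 →ₗ[ℂ] ℂ) : (X → 𝔸) →ₗ[ℂ] (X → 𝔸) →ₗ[ℂ] ℂ :=
  LinearMap.mk₂ ℂ (trPairY τ) (trPairY_add_left τ) (trPairY_smul_left τ) (trPairY_add_right τ) (trPairY_smul_right τ)

omit [CompleteSpace 𝔸] in
/-- the bilinear map evaluates to the pairing. [cite: Balaban1985BackgroundPropagators, (3.11) p.392, bookkeeping] -/
@[simp] theorem trPairBY_apply (τ : 𝔸 →ₗ[ℂ] ℂ) (Φ Ψ : X → 𝔸) : trPairBY τ Φ Ψ = trPairY τ Φ Ψ := rfl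

omit [CompleteSpace 𝔸] in
/-- the pairing against a delta function `δ_x ⊗ a` on the left is `τ(a·Ψ(x))`. [cite: Balaban1985BackgroundPropagators, (3.48) p.398 (kernels), bookkeeping] -/
theorem trPairY_single_left [DecidableEq X] (τ : 𝔸 →ₗ[ℂ] ℂ) (x : X) (a : 𝔸) (Ψ : X → 𝔸) :
    trPairY τ (Pi.single x a) Ψ = τ (a * Ψ x) := by
  rw [trPairY, Finset.sum_eq_single x]
  · rw [Pi.single_eq_same]
  · intro y _ hy; rw [Pi.single_eq_of_ne hy, zero_mul, map_zero]
  · intro h; exact absurd (Finset.mem_univ x) h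

variable (𝔸) in
/-- **a TRACE-DUAL FIBRE**: a tracial `ℂ`-linear functional `τ` («tr») together with the DUALISING MAP `ρ` of the bilinear pairing `(a, b) ↦ τ(ab)`
(`τ(a·ρ(f)) = f(a)`) and its separation — the structure that makes «the operator of a quadratic form» ((3.134): *«Let us define ⟨A,Δ⁽²⁾A⟩ = …»*)
a well-defined letter.  Instance of record: `M_N(ℂ)` with the matrix trace (`trDualMatY`). [cite: Balaban1985BackgroundPropagators, (3.134) p.422, dictionary] -/
structure TrDualY where
  /-- «tr» -/
  τ : 𝔸 →ₗ[ℂ] ℂ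
  /-- traciality `τ(ab) = τ(ba)` -/
  τ_comm : ∀ a b : 𝔸, τ (a * b) = τ (b * a)
  /-- the dualising map: the element representing a functional -/
  ρ : (𝔸 →ₗ[ℂ] ℂ) →ₗ[ℂ] 𝔸
  /-- `ρ(f)` represents `f` for the pairing `τ(a·b)` -/
  τ_mul_ρ : ∀ (f : 𝔸 →ₗ[ℂ] ℂ) (a : 𝔸), τ (a * ρ f) = f a
  /-- the pairing separates points on the right -/
  sep : ∀ a : 𝔸, (∀ b : 𝔸, τ (b * a) = 0) → a = 0

/-- ★ **THE TRACE-DUAL FIBRE OF RECORD** `M_N(ℂ)`: `τ = tr` (the UN-normalised `Matrix.trace`; print's trace is normalised, p. 392: *"Let us recall that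
the trace is normalized, i.e., tr 1 = 1"* — a common factor `N` on both sides of (3.134)'s defining identity, invisible in the operator `Δ⁽²⁾`, like the
dropped weights of (M4)), `ρ(f)_{pq} = f(E_{qp})` (matrix units), separation by `tr(E_{qp}·a) = a_{pq}`.
[cite: Balaban1985BackgroundPropagators, (3.11) p.392 («tr», «tr 1 = 1»), (3.134) p.422, dictionary] -/
def trDualMatY (N : ℕ) : TrDualY (Matrix (Fin N) (Fin N) ℂ) where
  τ := Matrix.traceLinearMap (Fin N) ℂ ℂ
  τ_comm := fun a b => Matrix.trace_mul_comm a b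
  ρ :=
    { toFun := fun f => Matrix.of fun p q => f (Matrix.single q p (1 : ℂ))
      map_add' := fun f g => by ext p q; rfl
      map_smul' := fun c f => by ext p q; rfl }
  τ_mul_ρ := fun f a => by
    show Matrix.trace (a * Matrix.of fun p q => f (Matrix.single q p (1 : ℂ))) = f a
    conv_rhs => rw [Matrix.matrix_eq_sum_single a]
    simp only [Matrix.trace, Matrix.diag_apply, Matrix.mul_apply, Matrix.of_apply, map_sum]
    refine Finset.sum_congr rfl fun p _ => Finset.sum_congr rfl fun q _ => ?_
    rw [← smul_eq_mul, ← map_smul, Matrix.smul_single, smul_eq_mul, mul_one]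
  sep := fun a h => by
    refine (Matrix.ext_iff_trace_mul_left (A := a) (B := 0)).2 fun x => ?_
    rw [Matrix.mul_zero, Matrix.trace_zero]
    exact h x

/-- the trace of record is the matrix trace. [cite: Balaban1985BackgroundPropagators, (3.11) p.392, bookkeeping] -/
@[simp] theorem trDualMatY_τ (N : ℕ) (a : Matrix (Fin N) (Fin N) ℂ) : (trDualMatY N).τ a = Matrix.trace a := rfl

/-- the dualising map of record, entrywise. [cite: Balaban1985BackgroundPropagators, (3.134) p.422, bookkeeping] -/
theorem trDualMatY_ρ_apply (N : ℕ) (f : Matrix (Fin N) (Fin N) ℂ →ₗ[ℂ] ℂ) (p q : Fin N) :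
    (trDualMatY N).ρ f p q = f (Matrix.single q p (1 : ℂ)) := rfl

variable (𝔡 : TrDualY 𝔸)

open Classical in
/-- ★ **THE DUALISING (RIESZ) MAP OF THE PAIRING ON LATTICE FUNCTIONS**: the function `ρ_X(F)` representing a functional `F` on `X → 𝔸`,
`ρ_X(F)(x) = ρ(a ↦ F(δ_x ⊗ a))`. [cite: Balaban1985BackgroundPropagators, (3.134) p.422 («Let us define ⟨A,Δ⁽²⁾A⟩ = …»), dictionary] -/
def rieszY : ((X → 𝔸) →ₗ[ℂ] ℂ) →ₗ[ℂ] (X → 𝔸) where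
  toFun F := fun x => 𝔡.ρ (F ∘ₗ LinearMap.single ℂ (fun _ : X => 𝔸) x)
  map_add' F G := by funext x; simp only [LinearMap.add_comp, map_add, Pi.add_apply]
  map_smul' c F := by funext x; simp only [LinearMap.smul_comp, map_smul, Pi.smul_apply, RingHom.id_apply]

omit [CompleteSpace 𝔸] [Fintype X] in
open Classical in
/-- the dualising map, pointwise. [cite: Balaban1985BackgroundPropagators, (3.134) p.422, bookkeeping] -/
theorem rieszY_apply (F : (X → 𝔸) →ₗ[ℂ] ℂ) (x : X) : rieszY 𝔡 F x = 𝔡.ρ (F ∘ₗ LinearMap.single ℂ (fun _ : X => 𝔸) x) := rfl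

omit [CompleteSpace 𝔸] in
/-- ★ **`ρ_X(F)` REPRESENTS `F`**: `⟨Φ, ρ_X(F)⟩_τ = F(Φ)`. [cite: Balaban1985BackgroundPropagators, (3.134) p.422, bookkeeping] -/
theorem trPairY_rieszY (F : (X → 𝔸) →ₗ[ℂ] ℂ) (Φ : X → 𝔸) : trPairY 𝔡.τ Φ (rieszY 𝔡 F) = F Φ := by
  classical
  calc trPairY 𝔡.τ Φ (rieszY 𝔡 F) = ∑ x, F (Pi.single x (Φ x)) := by
        refine Finset.sum_congr rfl fun x _ => ?_
        rw [rieszY_apply, 𝔡.τ_mul_ρ, LinearMap.comp_apply, LinearMap.single_apply]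
    _ = F (∑ x, Pi.single x (Φ x)) := by rw [map_sum]
    _ = F Φ := by rw [Finset.univ_sum_single]

omit [CompleteSpace 𝔸] in
/-- ★ **SEPARATION**: a lattice function is determined by its pairings on the left. [cite: Balaban1985BackgroundPropagators, (3.134) p.422, bookkeeping] -/
theorem trPairY_left_ext {Ψ Ψ' : X → 𝔸} (h : ∀ Φ : X → 𝔸, trPairY 𝔡.τ Φ Ψ = trPairY 𝔡.τ Φ Ψ') : Ψ = Ψ' := by
  classical
  funext x
  refine sub_eq_zero.1 (𝔡.sep _ fun b => ?_)
  rw [mul_sub, map_sub, sub_eq_zero, ← trPairY_single_left 𝔡.τ x b Ψ, ← trPairY_single_left 𝔡.τ x b Ψ']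
  exact h _

omit [CompleteSpace 𝔸] in
/-- ★ **UNIQUENESS OF THE REPRESENTING FUNCTION**. [cite: Balaban1985BackgroundPropagators, (3.134) p.422, bookkeeping] -/
theorem eq_rieszY_of_trPairY (F : (X → 𝔸) →ₗ[ℂ] ℂ) {Ψ : X → 𝔸} (h : ∀ Φ : X → 𝔸, trPairY 𝔡.τ Φ Ψ = F Φ) : Ψ = rieszY 𝔡 F :=
  trPairY_left_ext 𝔡 fun Φ => by rw [h, trPairY_rieszY]

/-- ★ **THE `τ`-TRANSPOSE `T†` OF A LETTER** between lattice-function spaces: `⟨Φ, T†Ψ⟩_τ = ⟨TΦ, Ψ⟩_τ` (print's `*` for the bilinear trace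
pairings, e.g. `H*` of (3.136); weights dropped as in (M4)). [cite: Balaban1985BackgroundPropagators, (3.136) p.422 («H*J»), (3.8)–(3.9) p.392, dictionary] -/
def trAdjY (T : (X → 𝔸) →ₗ[ℂ] (Y → 𝔸)) : (Y → 𝔸) →ₗ[ℂ] (X → 𝔸) :=
  rieszY 𝔡 ∘ₗ LinearMap.lcomp ℂ ℂ T ∘ₗ (trPairBY 𝔡.τ).flip

omit [CompleteSpace 𝔸] in
/-- ★ the transpose identity `⟨Φ, T†Ψ⟩_τ = ⟨TΦ, Ψ⟩_τ`. [cite: Balaban1985BackgroundPropagators, (3.136) p.422, (3.9) p.392, bookkeeping] -/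
theorem trPairY_trAdjY (T : (X → 𝔸) →ₗ[ℂ] (Y → 𝔸)) (Φ : X → 𝔸) (Ψ : Y → 𝔸) :
    trPairY 𝔡.τ Φ (trAdjY 𝔡 T Ψ) = trPairY 𝔡.τ (T Φ) Ψ := by
  rw [trAdjY, LinearMap.comp_apply, LinearMap.comp_apply, trPairY_rieszY]
  rfl

omit [CompleteSpace 𝔸] in
/-- the transpose identity with the arguments of the pairings swapped (tracial `τ`): `⟨T†Ψ, Φ⟩_τ = ⟨Ψ, TΦ⟩_τ`.
[cite: Balaban1985BackgroundPropagators, (3.136) p.422, bookkeeping] -/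
theorem trPairY_trAdjY_left (T : (X → 𝔸) →ₗ[ℂ] (Y → 𝔸)) (Φ : X → 𝔸) (Ψ : Y → 𝔸) :
    trPairY 𝔡.τ (trAdjY 𝔡 T Ψ) Φ = trPairY 𝔡.τ Ψ (T Φ) := by
  rw [trPairY_comm 𝔡.τ 𝔡.τ_comm, trPairY_trAdjY, trPairY_comm 𝔡.τ 𝔡.τ_comm]

end TraceDual

/-! ## §1 The current `J = D*η⁻²Im ∂U` of (3.11) ∕ (3.117) on NODE 00's carriers (r06's `B9Eq39Adjoint.J` BY NAME at the member's torus) -/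

section Current

variable {d ℓ : ℕ} {hd : 1 ≤ d + 1} {hL : Odd (ℓ + 1) ∧ 1 < ℓ + 1} {b₀ b₁ : ℝ}
variable {𝔸 : Type} [NormedRing 𝔸] [NormedAlgebra ℂ 𝔸] [CompleteSpace 𝔸]
variable (i : KIdx d ℓ hd hL b₀ b₁)

/-- `η` of the bond sector at the index (`= |c_f|⁻¹`, the fine lattice spacing; `B6KLevelCensusIndexV1`'s `eta`). [cite: Balaban1985BackgroundPropagators, p.389 (T_η), dictionary] -/
def etaBY : ℝ := |i.cf|⁻¹

/-- ★ **THE CURRENT `J(U) = D*_U η⁻² Im ∂U`** of (3.11) ∕ (3.117) as an `𝔸`-valued fine-bond function at the index: r06's `B9Eq39Adjoint.J` (the abstract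
exact-background lattice current) AT NODE 00's torus `(Site, shiftsV1, Fin (d+1))` and the member's `η`. [cite: Balaban1985BackgroundPropagators, (3.11) p.392, (3.117) p.419 («J = D*η⁻²Im ∂U»)] -/
def JY (U : CfgY 𝔸 i) : FBondY i → 𝔸 := fun b => B9Eq39Adjoint.J (shiftsV1 (PV d ℓ i.m i.K hd hL)) U (etaBY i) b.dir b.src

/-- the current, unfolded. [cite: Balaban1985BackgroundPropagators, (3.11) p.392, bookkeeping] -/
theorem JY_apply (U : CfgY 𝔸 i) (b : FBondY i) : JY i U b = B9Eq39Adjoint.J (shiftsV1 (PV d ℓ i.m i.K hd hL)) U (etaBY i) b.dir b.src := rfl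

omit [NormedAlgebra ℂ 𝔸] [CompleteSpace 𝔸] in
/-- the plaquette variables of the flat configuration are `1`. [cite: Balaban1985BackgroundPropagators, p.391 (U(∂p)), bookkeeping] -/
theorem plaqU_one {S ι : Type*} (T : ι → Equiv.Perm S) (μ ν : ι) (x : S) : B9Eq39Adjoint.plaqU T (fun _ _ => (1 : 𝔸ˣ)) μ ν x = 1 := by
  simp [B9Eq39Adjoint.plaqU]

omit [NormedAlgebra ℂ 𝔸] [CompleteSpace 𝔸] in
/-- `D*` of the zero plaquette function vanishes. [cite: Balaban1985BackgroundPropagators, (3.9) p.392, bookkeeping] -/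
theorem divP_zero {S ι : Type*} [Fintype ι] [LinearOrder ι] (T : ι → Equiv.Perm S) (U : ι → S → 𝔸ˣ) (μ : ι) (x : S) :
    B9Eq39Adjoint.divP T U (0 : ι → ι → S → 𝔸) μ x = 0 := by
  simp [B9Eq39Adjoint.divP, B9Eq39Adjoint.covDstar_zero]

/-- ★ **`J(1) = 0`** — a one-line inference from (3.11) (`∂U = 1 ⇒ Im ∂U = 0 ⇒ J = 0`; not a printed sentence), which is why `Δ⁽²⁾(1) = 0` (`delta2OfY_one`).
[cite: Balaban1985BackgroundPropagators, (3.11) p.392, (3.117) p.419, bookkeeping] -/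
theorem JY_one (b : FBondY i) : JY i (fun _ _ => (1 : 𝔸ˣ)) b = 0 := by
  have hF : (fun μ ν x => (((etaBY i : ℝ) : ℂ)⁻¹ ^ 2) •
      B9Eq37Insertion.imC (B9Eq39Adjoint.plaqU (shiftsV1 (PV d ℓ i.m i.K hd hL)) (fun _ _ => (1 : 𝔸ˣ)) μ ν x)) = 0 := by
    funext μ ν x; rw [plaqU_one, B9Eq37Insertion.imC_one, smul_zero]; rfl
  rw [JY_apply, B9Eq39Adjoint.J, B9Eq39Adjoint.divPη, hF, divP_zero, smul_zero]

/-- the whole current vanishes at `U = 1`. [cite: Balaban1985BackgroundPropagators, (3.117) p.419, bookkeeping] -/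
theorem JY_one' : JY i (fun _ _ => (1 : 𝔸ˣ)) = 0 := funext (JY_one i)

/-- the torus shifts of the member commute. [cite: Balaban1985BackgroundPropagators, p.389 (T_η a torus), bookkeeping] -/
theorem shiftsV1_comm (μ ν : Fin (d + 1)) (x : Site (PV d ℓ i.m i.K hd hL) 0) :
    shiftsV1 (PV d ℓ i.m i.K hd hL) μ (shiftsV1 (PV d ℓ i.m i.K hd hL) ν x) =
      shiftsV1 (PV d ℓ i.m i.K hd hL) ν (shiftsV1 (PV d ℓ i.m i.K hd hL) μ x) :=
  B5Local114G0Second.shift_shift_comm x ν μ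

/-- ★ **(3.117), FIRST IDENTITY, AT NODE 00: `D*J = 0`** (current conservation) — r06's `B9Eq3117Current.divB_J_eq_zero` at the member's torus.
[cite: Balaban1985BackgroundPropagators, (3.117) p.419 («⟨Dλ, J⟩ = 0, or D*J = 0»)] -/
theorem divB_JY_eq_zero (U : CfgY 𝔸 i) (x : Site (PV d ℓ i.m i.K hd hL) 0) :
    B9Eq39Adjoint.divB (shiftsV1 (PV d ℓ i.m i.K hd hL)) U (fun μ s => JY i U ⟨s, μ⟩) x = 0 :=
  B9Eq3117Current.divB_J_eq_zero (shiftsV1 (PV d ℓ i.m i.K hd hL)) U (shiftsV1_comm i) (etaBY i) x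

end Current

/-! ## §2 The letter `C⁽²⁾` — the second-order term of [5]'s averaging operation, polarised ([B11] (56) «C⁽²⁾(A, A′)») -/

section Form

variable {d ℓ : ℕ} {hd : 1 ≤ d + 1} {hL : Odd (ℓ + 1) ∧ 1 < ℓ + 1} {b₀ b₁ : ℝ}
variable (𝔸 : Type) [NormedRing 𝔸] [NormedAlgebra ℂ 𝔸] [CompleteSpace 𝔸]

/-- **THE LETTER `C⁽²⁾(U; A, A′)`**: the POLARISED second-order term of [5]'s non-linear averaging operation `C(A)` ((136) p. 39 of [5]; «C⁽²⁾ is of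
second order»: p. 421 after (3.127), p. 393 after (3.14)), a `U`-dependent SYMMETRIC `ℂ`-bilinear map from pairs of fine-bond functions to coarse-bond functions (values on `𝔅`, the
domain of `H` in (3.134)); `C⁽²⁾(A) = C⁽²⁾(U; A, A)`.  Its lattice formula is [5]'s and is NOT an object of NODE 00's tree — it is the ONE residual
parameter of this file (flat witness `c2LettersY_flat`; the intended instance is `B7Eq136SecondOrder.CCovIter2`'s second derivative, level by level).
[cite: Balaban1985BackgroundPropagators, (3.134) p.422, p.421 («a second order term in the expansion of Q_j(ηA)»), p.393; Balaban1985Averaging, (136) p.39; Balaban1985Variational, (56) p.286 («C⁽²⁾(A′, A″) … by polarization»)] -/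
structure C2LettersY (i : KIdx d ℓ hd hL b₀ b₁) where
  /-- `(A, A′) ↦ C⁽²⁾(U; A, A′)` -/
  form : CfgY 𝔸 i → (FBondY i → 𝔸) →ₗ[ℂ] (FBondY i → 𝔸) →ₗ[ℂ] (IBondY i → 𝔸)
  /-- polarised forms are symmetric -/
  symm : ∀ (U : CfgY 𝔸 i) (A A' : FBondY i → 𝔸), form U A A' = form U A' A

/-- the flat letter `C⁽²⁾ := 0` (nonvacuity; NOT [5]'s `C⁽²⁾` away from the linear averaging). [cite: Balaban1985BackgroundPropagators, (3.134) p.422, bookkeeping] -/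
def c2LettersY_flat (i : KIdx d ℓ hd hL b₀ b₁) : C2LettersY 𝔸 i := ⟨fun _ => 0, fun _ _ _ => rfl⟩

/-- the flat letter's form is `0`. [cite: Balaban1985BackgroundPropagators, (3.134) p.422, bookkeeping] -/
@[simp] theorem c2LettersY_flat_form (i : KIdx d ℓ hd hL b₀ b₁) (U : CfgY 𝔸 i) : (c2LettersY_flat 𝔸 i).form U = 0 := rfl

end Form

/-! ## §3 ★ `Δ⁽²⁾(U)` OF (3.134) AS A FUNCTION OF `C⁽²⁾`: the operator of the quadratic form `A ↦ 2⟨HC⁽²⁾(A), J⟩` -/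

section Delta2

variable {d ℓ : ℕ} {hd : 1 ≤ d + 1} {hL : Odd (ℓ + 1) ∧ 1 < ℓ + 1} {b₀ b₁ : ℝ}
variable {𝔸 : Type} [NormedRing 𝔸] [NormedAlgebra ℂ 𝔸] [CompleteSpace 𝔸]
variable (𝔡 : TrDualY 𝔸) (i : KIdx d ℓ hd hL b₀ b₁) (parS : SiteParY 𝔸 i) (parB : BondParY 𝔸 i) (Gp : SiteOpY 𝔸 i)

/-- the functional `B ↦ ⟨HB, J⟩_τ` on coarse-bond functions (`H = H(U)` of (3.126), `J = J(U)` of (3.117)). [cite: Balaban1985BackgroundPropagators, (3.134) p.422, (3.126) p.420] -/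
def pairHJY (U : CfgY 𝔸 i) : (IBondY i → 𝔸) →ₗ[ℂ] ℂ := (trPairBY 𝔡.τ).flip (JY i U) ∘ₗ HDY i parS parB Gp U

/-- the functional, evaluated. [cite: Balaban1985BackgroundPropagators, (3.134) p.422, bookkeeping] -/
@[simp] theorem pairHJY_apply (U : CfgY 𝔸 i) (B : IBondY i → 𝔸) :
    pairHJY 𝔡 i parS parB Gp U B = trPairY 𝔡.τ (HDY i parS parB Gp U B) (JY i U) := rfl

/-- ★★ **`Δ⁽²⁾(U)` OF (3.134)** — *«Let us define ⟨A, Δ⁽²⁾A⟩ = 2⟨HC⁽²⁾(A), J⟩»*: THE operator of this quadratic form for the trace pairing, i.e. the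
`τ`-symmetric bond-sector letter with `⟨A′, Δ⁽²⁾(U)A⟩_τ = 2⟨H(U)C⁽²⁾(U; A, A′), J(U)⟩_τ` (`trPairY_delta2OfY`; uniqueness `delta2OfY_unique`), as a
FUNCTION of the letter `C⁽²⁾` (and of def-Y's `H`, r06's `J`): `Δ⁽²⁾(U)A = 2·ρ_X(A′ ↦ ⟨HC⁽²⁾(A, A′), J⟩)`. [cite: Balaban1985BackgroundPropagators, (3.134) p.422, (3.136) p.422] -/
def delta2OfY (C : CfgY 𝔸 i → (FBondY i → 𝔸) →ₗ[ℂ] (FBondY i → 𝔸) →ₗ[ℂ] (IBondY i → 𝔸)) : BondOpY 𝔸 i := fun U =>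
  (2 : ℂ) • (rieszY 𝔡 ∘ₗ LinearMap.llcomp ℂ (FBondY i → 𝔸) (IBondY i → 𝔸) ℂ (pairHJY 𝔡 i parS parB Gp U) ∘ₗ C U)

variable (C : CfgY 𝔸 i → (FBondY i → 𝔸) →ₗ[ℂ] (FBondY i → 𝔸) →ₗ[ℂ] (IBondY i → 𝔸))

/-- ★★ **(3.134) POLARISED ∕ (3.136)**: `⟨A′, Δ⁽²⁾(U)A⟩_τ = 2⟨H(U)C⁽²⁾(U; A, A′), J(U)⟩_τ`. [cite: Balaban1985BackgroundPropagators, (3.134) p.422, (3.136) p.422] -/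
theorem trPairY_delta2OfY (U : CfgY 𝔸 i) (A A' : FBondY i → 𝔸) :
    trPairY 𝔡.τ A' (delta2OfY 𝔡 i parS parB Gp C U A) = 2 * trPairY 𝔡.τ (HDY i parS parB Gp U (C U A A')) (JY i U) := by
  rw [delta2OfY, LinearMap.smul_apply, trPairY_smul_right, LinearMap.comp_apply, LinearMap.comp_apply, trPairY_rieszY]
  rfl

/-- ★★★ **(3.134) VERBATIM**: `⟨A, Δ⁽²⁾A⟩ = 2⟨HC⁽²⁾(A), J⟩`, `C⁽²⁾(A) = C⁽²⁾(U; A, A)`. [cite: Balaban1985BackgroundPropagators, (3.134) p.422] -/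
theorem trPairY_delta2OfY_self (U : CfgY 𝔸 i) (A : FBondY i → 𝔸) :
    trPairY 𝔡.τ A (delta2OfY 𝔡 i parS parB Gp C U A) = 2 * trPairY 𝔡.τ (HDY i parS parB Gp U (C U A A)) (JY i U) :=
  trPairY_delta2OfY 𝔡 i parS parB Gp C U A A

/-- ★ **(3.136) WITH `H*`**: `⟨A′, Δ⁽²⁾A⟩_τ = 2⟨C⁽²⁾(A, A′), H†J⟩_τ` — print's «(H*J)(b)» moved onto the form by the `τ`-transpose (`trAdjY`); the `2` is
print's `δ∕δA` acting on the QUADRATIC `C_j⁽²⁾(A) = C_j⁽²⁾(A, A)` ((3.136) displays no explicit `2`). [cite: Balaban1985BackgroundPropagators, (3.136) p.422 («(H*J)(b)»)] -/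
theorem trPairY_delta2OfY_trAdj (U : CfgY 𝔸 i) (A A' : FBondY i → 𝔸) :
    trPairY 𝔡.τ A' (delta2OfY 𝔡 i parS parB Gp C U A) = 2 * trPairY 𝔡.τ (C U A A') (trAdjY 𝔡 (HDY i parS parB Gp U) (JY i U)) := by
  rw [trPairY_delta2OfY, trPairY_trAdjY]

/-- ★ **`Δ⁽²⁾(U)` IS `τ`-SYMMETRIC** for a symmetric `C⁽²⁾(U; ·, ·)`: `⟨A′, Δ⁽²⁾A⟩_τ = ⟨A, Δ⁽²⁾A′⟩_τ`. [cite: Balaban1985BackgroundPropagators, (3.134) p.422 (a quadratic form's operator)] -/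
theorem trPairY_delta2OfY_symm (hC : ∀ (U : CfgY 𝔸 i) (A A' : FBondY i → 𝔸), C U A A' = C U A' A) (U : CfgY 𝔸 i) (A A' : FBondY i → 𝔸) :
    trPairY 𝔡.τ A' (delta2OfY 𝔡 i parS parB Gp C U A) = trPairY 𝔡.τ A (delta2OfY 𝔡 i parS parB Gp C U A') := by
  rw [trPairY_delta2OfY, trPairY_delta2OfY, hC]

/-- ★ `τ`-symmetry in the shape `⟨Δ⁽²⁾A, B⟩_τ = ⟨A, Δ⁽²⁾B⟩_τ` (the shape of def-Y's `IsSymmTr` consumers). [cite: Balaban1985BackgroundPropagators, (3.134) p.422, bookkeeping] -/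
theorem trPairY_delta2OfY_symm' (hC : ∀ (U : CfgY 𝔸 i) (A A' : FBondY i → 𝔸), C U A A' = C U A' A) (U : CfgY 𝔸 i) (A B : FBondY i → 𝔸) :
    trPairY 𝔡.τ (delta2OfY 𝔡 i parS parB Gp C U A) B = trPairY 𝔡.τ A (delta2OfY 𝔡 i parS parB Gp C U B) := by
  rw [trPairY_comm 𝔡.τ 𝔡.τ_comm, trPairY_delta2OfY_symm 𝔡 i parS parB Gp C hC]

omit [CompleteSpace 𝔸] in
/-- the polarisation identity for a `τ`-symmetric letter: `2⟨A′, TA⟩ = ⟨A+A′, T(A+A′)⟩ − ⟨A, TA⟩ − ⟨A′, TA′⟩`. [cite: Balaban1985BackgroundPropagators, (3.134) p.422, bookkeeping] -/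
theorem trPairY_polarize {X : Type} [Fintype X] (T : (X → 𝔸) →ₗ[ℂ] (X → 𝔸))
    (hT : ∀ A B : X → 𝔸, trPairY 𝔡.τ (T A) B = trPairY 𝔡.τ A (T B)) (A A' : X → 𝔸) :
    2 * trPairY 𝔡.τ A' (T A) = trPairY 𝔡.τ (A + A') (T (A + A')) - trPairY 𝔡.τ A (T A) - trPairY 𝔡.τ A' (T A') := by
  have h : trPairY 𝔡.τ A (T A') = trPairY 𝔡.τ A' (T A) := by rw [← hT, trPairY_comm 𝔡.τ 𝔡.τ_comm]
  rw [map_add, trPairY_add_left, trPairY_add_right, trPairY_add_right, h]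
  ring

/-- ★★ **UNIQUENESS — (3.134) DEFINES `Δ⁽²⁾`**: a `τ`-symmetric bond-sector operator with the quadratic form `2⟨HC⁽²⁾(A), J⟩` IS `Δ⁽²⁾(U)`
(polarisation + separation of the trace pairing). [cite: Balaban1985BackgroundPropagators, (3.134) p.422 («Let us define»)] -/
theorem delta2OfY_unique (hC : ∀ (U : CfgY 𝔸 i) (A A' : FBondY i → 𝔸), C U A A' = C U A' A) (U : CfgY 𝔸 i)
    (T : (FBondY i → 𝔸) →ₗ[ℂ] (FBondY i → 𝔸)) (hT : ∀ A B : FBondY i → 𝔸, trPairY 𝔡.τ (T A) B = trPairY 𝔡.τ A (T B))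
    (h134 : ∀ A : FBondY i → 𝔸, trPairY 𝔡.τ A (T A) = 2 * trPairY 𝔡.τ (HDY i parS parB Gp U (C U A A)) (JY i U)) :
    T = delta2OfY 𝔡 i parS parB Gp C U := by
  refine LinearMap.ext fun A => trPairY_left_ext 𝔡 fun A' => ?_
  have h2 : (2 : ℂ) ≠ 0 := two_ne_zero
  refine mul_left_cancel₀ h2 ?_
  rw [trPairY_polarize 𝔡 T hT, trPairY_polarize 𝔡 _ (trPairY_delta2OfY_symm' 𝔡 i parS parB Gp C hC U), h134, h134, h134,
    trPairY_delta2OfY_self, trPairY_delta2OfY_self, trPairY_delta2OfY_self]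

/-- ★ **`Δ⁽²⁾(1) = 0`** — the lineage's `U = 1` clause of the residual letter (`ResLettersY`), now a THEOREM of the construction (`JY_one`: `∂U = 1 ⇒ J = 0`).
[cite: Balaban1985BackgroundPropagators, (3.134) p.422, (3.11) p.392, bookkeeping] -/
theorem delta2OfY_one : delta2OfY 𝔡 i parS parB Gp C (fun _ _ => 1) = 0 := by
  refine LinearMap.ext fun A => trPairY_left_ext 𝔡 fun A' => ?_
  rw [trPairY_delta2OfY, JY_one', trPairY_zero_right, mul_zero, LinearMap.zero_apply, trPairY_zero_right]

/-- `Δ⁽²⁾ ≡ 0` for the flat letter `C⁽²⁾ = 0`. [cite: Balaban1985BackgroundPropagators, (3.134) p.422, bookkeeping] -/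
theorem delta2OfY_flat (U : CfgY 𝔸 i) : delta2OfY 𝔡 i parS parB Gp (fun _ => 0) U = 0 := by
  refine LinearMap.ext fun A => trPairY_left_ext 𝔡 fun A' => ?_
  rw [trPairY_delta2OfY, LinearMap.zero_apply, LinearMap.zero_apply, map_zero, trPairY_zero_left, mul_zero, LinearMap.zero_apply,
    trPairY_zero_right]

end Delta2

/-! ## §4 ★★ The residual letter and the instance of record as FUNCTIONS of `C⁽²⁾`: `res134OfC2Y`, `resYOfC2`, `opsYOfRecordV7E` -/

section Residual

variable {d ℓ : ℕ} {hd : 1 ≤ d + 1} {hL : Odd (ℓ + 1) ∧ 1 < ℓ + 1} {b₀ b₁ : ℝ} {Mstar : ℕ}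
variable {𝔸 : Type} [NormedRing 𝔸] [NormedAlgebra ℂ 𝔸] [CompleteSpace 𝔸] (𝔡 : TrDualY 𝔸)

/-- ★★ **THE RESIDUAL LETTER OF (3.134) AS A FUNCTION OF `C⁽²⁾`** at a member: `Δ⁽²⁾(U)` built from def-Y's `H` OF RECORD (`HDY` over `parSymY`,
`parBY`, `GpY parSymY` — the v4 record's `H`, `covLettersY_v4_H`) and r06's `J`, with its `U = 1` clause PROVED. [cite: Balaban1985BackgroundPropagators, (3.134) p.422, (3.126) p.420, (3.117) p.419] -/
def res134OfC2Y (x : MemberY d ℓ hd hL b₀ b₁ Mstar) (𝔠 : C2LettersY 𝔸 x.toKIdx) : ResLettersY 𝔸 x :=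
  ⟨delta2OfY 𝔡 x.toKIdx (parSymY x.toKIdx) (parBY x.toKIdx) (GpY x.toKIdx (parSymY x.toKIdx)) 𝔠.form,
    delta2OfY_one 𝔡 x.toKIdx (parSymY x.toKIdx) (parBY x.toKIdx) (GpY x.toKIdx (parSymY x.toKIdx)) 𝔠.form⟩

/-- the residual letter's `Δ⁽²⁾`, unfolded. [cite: Balaban1985BackgroundPropagators, (3.134) p.422, bookkeeping] -/
theorem res134OfC2Y_Δ2 (x : MemberY d ℓ hd hL b₀ b₁ Mstar) (𝔠 : C2LettersY 𝔸 x.toKIdx) :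
    (res134OfC2Y 𝔡 x 𝔠).Δ2 = delta2OfY 𝔡 x.toKIdx (parSymY x.toKIdx) (parBY x.toKIdx) (GpY x.toKIdx (parSymY x.toKIdx)) 𝔠.form := rfl

/-- ★ (3.134) for the residual letter at the record's `H`: `⟨A′, Δ⁽²⁾A⟩_τ = 2⟨HC⁽²⁾(A, A′), J⟩_τ`. [cite: Balaban1985BackgroundPropagators, (3.134) p.422] -/
theorem trPairY_res134OfC2Y (x : MemberY d ℓ hd hL b₀ b₁ Mstar) (𝔠 : C2LettersY 𝔸 x.toKIdx) (U : CfgY 𝔸 x.toKIdx) (A A' : FBondY x.toKIdx → 𝔸) :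
    trPairY 𝔡.τ A' ((res134OfC2Y 𝔡 x 𝔠).Δ2 U A) =
      2 * trPairY 𝔡.τ (HDY x.toKIdx (parSymY x.toKIdx) (parBY x.toKIdx) (GpY x.toKIdx (parSymY x.toKIdx)) U (𝔠.form U A A')) (JY x.toKIdx U) :=
  trPairY_delta2OfY 𝔡 _ _ _ _ _ U A A'

/-- ★ the residual letter is `τ`-symmetric. [cite: Balaban1985BackgroundPropagators, (3.134) p.422] -/
theorem trPairY_res134OfC2Y_symm (x : MemberY d ℓ hd hL b₀ b₁ Mstar) (𝔠 : C2LettersY 𝔸 x.toKIdx) (U : CfgY 𝔸 x.toKIdx) (A B : FBondY x.toKIdx → 𝔸) :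
    trPairY 𝔡.τ ((res134OfC2Y 𝔡 x 𝔠).Δ2 U A) B = trPairY 𝔡.τ A ((res134OfC2Y 𝔡 x 𝔠).Δ2 U B) :=
  trPairY_delta2OfY_symm' 𝔡 _ _ _ _ _ 𝔠.symm U A B

/-- the flat `C⁽²⁾` gives the flat residual letter's `Δ⁽²⁾ = 0`. [cite: Balaban1985BackgroundPropagators, (3.134) p.422, bookkeeping] -/
theorem res134OfC2Y_flat_Δ2 (x : MemberY d ℓ hd hL b₀ b₁ Mstar) (U : CfgY 𝔸 x.toKIdx) :
    (res134OfC2Y 𝔡 x (c2LettersY_flat 𝔸 x.toKIdx)).Δ2 U = 0 :=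
  delta2OfY_flat 𝔡 _ _ _ _ U

end Residual

section Record

variable (N : ℕ) (θ : Stage3Params) (Mstar : ℕ)

/-- the letters `C⁽²⁾` of a Stage 3′(Y) family: one per member, `𝔸 = M_N(ℂ)`. [cite: Balaban1985BackgroundPropagators, (3.134) p.422; Balaban1985Averaging, (136) p.39] -/
abbrev C2Y : Type := ∀ x : MemberY θ.d₆ θ.ℓ₆ θ.hd' θ.hL' θ.b₀ θ.b₁ Mstar, C2LettersY (Matrix (Fin N) (Fin N) ℂ) x.toKIdx

/-- the flat family (nonvacuity). [cite: Balaban1985BackgroundPropagators, (3.134) p.422, bookkeeping] -/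
def c2Y_flat : C2Y N θ Mstar := fun x => c2LettersY_flat (Matrix (Fin N) (Fin N) ℂ) x.toKIdx

/-- ★★ **THE RESIDUAL FAMILY OF RECORD AS A FUNCTION OF `C⁽²⁾`**: member by member `res134OfC2Y` at the trace-dual fibre of record `M_N(ℂ)`.
[cite: Balaban1985BackgroundPropagators, (3.134) p.422] -/
def resYOfC2 (𝔠 : C2Y N θ Mstar) : ResY N θ Mstar := fun x => res134OfC2Y (trDualMatY N) x (𝔠 x)

/-- ★★★ **THE v7 INSTANCE OF RECORD** of Stage 3′(Y): the v6 instance `opsYOfRecordV6E` with the residual family `𝔯` NO LONGER A PARAMETER but the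
function `resYOfC2 𝔠` of the letters `C⁽²⁾` — every `opsYOfRecordV6E_…` ∕ `opsYOfRecordV4E_…` face applies verbatim (`opsYOfRecordV7E_eq`).
Remaining parametric letters: `𝔠` ([5]'s `C⁽²⁾`), `𝔢₀.D2J`, `𝔢₀.Gt2`, `𝔴`, `𝔈`. [cite: Balaban1985BackgroundPropagators, Thms 3.1–3.15 pp.397–432, (3.134) p.422] -/
def opsYOfRecordV7E (𝔠 : C2Y N θ Mstar) (𝔢₀ : SectEY N θ Mstar) (𝔴 : RWEY N θ Mstar) (𝔈 : ExpsY N θ Mstar) : OpsY N θ Mstar :=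
  opsYOfRecordV6E N θ Mstar (resYOfC2 N θ Mstar 𝔠) 𝔢₀ 𝔴 𝔈

variable (𝔠 : C2Y N θ Mstar) (𝔢₀ : SectEY N θ Mstar) (𝔴 : RWEY N θ Mstar) (𝔈 : ExpsY N θ Mstar)

/-- the v7 instance is the v6 instance at the residual family `resYOfC2 𝔠`. [cite: Balaban1985BackgroundPropagators, (3.134) p.422, bookkeeping] -/
theorem opsYOfRecordV7E_eq : opsYOfRecordV7E N θ Mstar 𝔠 𝔢₀ 𝔴 𝔈 = opsYOfRecordV6E N θ Mstar (resYOfC2 N θ Mstar 𝔠) 𝔢₀ 𝔴 𝔈 := rfl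

/-- … and the v4 instance at the v6 Sect. E letters. [cite: Balaban1985BackgroundPropagators, (3.157) p.428, bookkeeping] -/
theorem opsYOfRecordV7E_eq_V4E :
    opsYOfRecordV7E N θ Mstar 𝔠 𝔢₀ 𝔴 𝔈 = opsYOfRecordV4E N θ Mstar (resYOfC2 N θ Mstar 𝔠) (sectEYOfRecordV6 N θ Mstar 𝔢₀) 𝔴 𝔈 := rfl

/-- the residual family of record at a member. [cite: Balaban1985BackgroundPropagators, (3.134) p.422, bookkeeping] -/
theorem resYOfC2_apply (x : MemberY θ.d₆ θ.ℓ₆ θ.hd' θ.hL' θ.b₀ θ.b₁ Mstar) : resYOfC2 N θ Mstar 𝔠 x = res134OfC2Y (trDualMatY N) x (𝔠 x) := rfl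

/-- the residual family's `Δ⁽²⁾` at a member, unfolded to `delta2OfY` at the record's `H`. [cite: Balaban1985BackgroundPropagators, (3.134) p.422, bookkeeping] -/
theorem resYOfC2_Δ2 (x : MemberY θ.d₆ θ.ℓ₆ θ.hd' θ.hL' θ.b₀ θ.b₁ Mstar) :
    (resYOfC2 N θ Mstar 𝔠 x).Δ2 =
      delta2OfY (trDualMatY N) x.toKIdx (parSymY x.toKIdx) (parBY x.toKIdx) (GpY x.toKIdx (parSymY x.toKIdx)) (𝔠 x).form := rfl

/-- ★★★ **(3.134) AT THE RECORD, IN MATRIX TRACES**: `Σ_b tr(A′(b)·(Δ⁽²⁾(U)A)(b)) = 2·Σ_b tr((H(U)C⁽²⁾(U; A, A′))(b)·J(U)(b))`.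
[cite: Balaban1985BackgroundPropagators, (3.134) p.422, (3.136) p.422] -/
theorem sum_trace_resYOfC2_Δ2 (x : MemberY θ.d₆ θ.ℓ₆ θ.hd' θ.hL' θ.b₀ θ.b₁ Mstar) (U : CfgY (Matrix (Fin N) (Fin N) ℂ) x.toKIdx)
    (A A' : FBondY x.toKIdx → Matrix (Fin N) (Fin N) ℂ) :
    ∑ b, Matrix.trace (A' b * (resYOfC2 N θ Mstar 𝔠 x).Δ2 U A b) =
      2 * ∑ b, Matrix.trace (HDY x.toKIdx (parSymY x.toKIdx) (parBY x.toKIdx) (GpY x.toKIdx (parSymY x.toKIdx)) U ((𝔠 x).form U A A') b *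
        JY x.toKIdx U b) :=
  trPairY_res134OfC2Y (trDualMatY N) x (𝔠 x) U A A'

/-- ★ the record's `Δ⁽²⁾(U)` is trace-symmetric: `Σ_b tr((Δ⁽²⁾A)(b)B(b)) = Σ_b tr(A(b)(Δ⁽²⁾B)(b))`. [cite: Balaban1985BackgroundPropagators, (3.134) p.422] -/
theorem sum_trace_resYOfC2_Δ2_symm (x : MemberY θ.d₆ θ.ℓ₆ θ.hd' θ.hL' θ.b₀ θ.b₁ Mstar) (U : CfgY (Matrix (Fin N) (Fin N) ℂ) x.toKIdx)
    (A B : FBondY x.toKIdx → Matrix (Fin N) (Fin N) ℂ) :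
    ∑ b, Matrix.trace ((resYOfC2 N θ Mstar 𝔠 x).Δ2 U A b * B b) = ∑ b, Matrix.trace (A b * (resYOfC2 N θ Mstar 𝔠 x).Δ2 U B b) :=
  trPairY_res134OfC2Y_symm (trDualMatY N) x (𝔠 x) U A B

/-- the flat `C⁽²⁾` family reproduces the flat residual family's `Δ⁽²⁾ = 0` member by member. [cite: Balaban1985BackgroundPropagators, (3.134) p.422, bookkeeping] -/
theorem resYOfC2_flat_Δ2 (x : MemberY θ.d₆ θ.ℓ₆ θ.hd' θ.hL' θ.b₀ θ.b₁ Mstar) (U : CfgY (Matrix (Fin N) (Fin N) ℂ) x.toKIdx) :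
    (resYOfC2 N θ Mstar (c2Y_flat N θ Mstar) x).Δ2 U = (resY_flat N θ Mstar x).Δ2 U :=
  res134OfC2Y_flat_Δ2 (trDualMatY N) x U

end Record

/-! ## §5 From `τ`-symmetry to def-Y's Hermitian `IsSymmTr`: real letters (the consumer hypothesis `hΔ2` of `Node00.OpsYSectDESymm`) -/

section Hermitian

variable {N : ℕ}

/-- ★ **A `τ`-SYMMETRIC REAL LETTER IS SYMMETRIC FOR THE HERMITIAN TRACE PAIRING**: if `Σ tr((TΦ)Ψ) = Σ tr(Φ(TΨ))` and `T` commutes with the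
pointwise conjugate transpose, then `IsSymmTr 1 T` (def-Y's ∕ n06's «symmetric» currency, `B9Thm311ReadingCoords.IsSymmTr`).
[cite: Balaban1985BackgroundPropagators, Thm 3.11 p.416 («symmetric»), (3.134) p.422, bookkeeping] -/
theorem isSymmTr_of_trSymm_of_real {S : Type} [Fintype S] (T : (S → Matrix (Fin N) (Fin N) ℂ) →ₗ[ℂ] (S → Matrix (Fin N) (Fin N) ℂ))
    (hsymm : ∀ Φ Ψ : S → Matrix (Fin N) (Fin N) ℂ, ∑ s, Matrix.trace (T Φ s * Ψ s) = ∑ s, Matrix.trace (Φ s * T Ψ s))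
    (hreal : ∀ Φ : S → Matrix (Fin N) (Fin N) ℂ, T (star Φ) = star (T Φ)) :
    IsSymmTr (fun _ => (1 : ℝ)) T := by
  intro Φ Ψ
  rw [B9Thm311ReadingCoords.trIP_eq_re_trace, B9Thm311ReadingCoords.trIP_eq_re_trace]
  simp only [one_mul]
  rw [← Complex.re_sum, ← Complex.re_sum]
  congr 1
  have h := hsymm (star Φ) Ψ
  rw [hreal] at h
  simpa only [Pi.star_apply, Matrix.star_eq_conjTranspose] using h

variable (θ : Stage3Params) (Mstar : ℕ) (𝔠 : C2Y N θ Mstar)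

/-- ★ **`hΔ2` OF `Node00.OpsYSectDESymm` FOR THE RESIDUAL FAMILY OF RECORD, FROM REALITY OF `Δ⁽²⁾(U)`**: at a configuration where the record's
`Δ⁽²⁾(U)` commutes with the pointwise adjoint `⋆` (a REAL letter; discharged from the letters in `resYOfC2_Δ2_isSymmTr` below), `Δ⁽²⁾(U)` is symmetric in
def-Y's Hermitian currency, so `G₁_isSymmTr_ofRecordV4` ∕ `GG_isSymmTr_ofRecordV4` apply to `𝔯 := resYOfC2 𝔠`. [cite: Balaban1985BackgroundPropagators, (3.134) p.422, Thm 3.11 p.416] -/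
theorem resYOfC2_Δ2_isSymmTr_of_star (x : MemberY θ.d₆ θ.ℓ₆ θ.hd' θ.hL' θ.b₀ θ.b₁ Mstar) (U : CfgY (Matrix (Fin N) (Fin N) ℂ) x.toKIdx)
    (hreal : ∀ A : FBondY x.toKIdx → Matrix (Fin N) (Fin N) ℂ, (resYOfC2 N θ Mstar 𝔠 x).Δ2 U (star A) = star ((resYOfC2 N θ Mstar 𝔠 x).Δ2 U A)) :
    IsSymmTr (fun _ => (1 : ℝ)) ((resYOfC2 N θ Mstar 𝔠 x).Δ2 U) :=
  isSymmTr_of_trSymm_of_real _ (sum_trace_resYOfC2_Δ2_symm N θ Mstar 𝔠 x U) hreal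

end Hermitian

/-! ## §6 Reality: `J(U)⋆ = J(U)` at unitary `U` ((3.11) with «Im»), and `Δ⁽²⁾(U)` is REAL for real letters `C⁽²⁾`, `H` -/

section StarCurrent

variable {𝔸 : Type*} [Ring 𝔸] [StarRing 𝔸] [Algebra ℂ 𝔸] [StarModule ℂ 𝔸] {S : Type*} {ι : Type*} [Fintype ι] [LinearOrder ι]
variable (T : ι → Equiv.Perm S) (U : ι → S → 𝔸ˣ)

/-- ★ **THE CURRENT IS SELF-ADJOINT AT A UNITARY BACKGROUND**: `J(U)_μ(x)⋆ = J(U)_μ(x)` — «Im ∂U» is self-adjoint (`B9Eq37Insertion.star_imC` at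
pv27's `B9Eq310Hermitian.plaqU_unitary`), `D*` is real (pv27's `B9Eq310Hermitian.star_divP` BY NAME), `η` is real (`B9Eq310Hermitian.star_eta_inv ∕
star_eta_sq`).  Hypothesis in `B9Eq310Hermitian`'s orientation `U_μ(y)⁻¹ = U_μ(y)⋆`. [cite: Balaban1985BackgroundPropagators, (3.11) p.392, p.391 (Im), (3.117) p.419] -/
theorem star_J (hU : ∀ μ y, (((U μ y)⁻¹ : 𝔸ˣ) : 𝔸) = star ((U μ y : 𝔸ˣ) : 𝔸)) (η : ℝ) (μ : ι) (x : S) :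
    star (B9Eq39Adjoint.J T U η μ x) = B9Eq39Adjoint.J T U η μ x := by
  have hF : star (fun κ ν y => (((η : ℂ)⁻¹) ^ 2) • B9Eq37Insertion.imC (B9Eq39Adjoint.plaqU T U κ ν y)) =
      fun κ ν y => (((η : ℂ)⁻¹) ^ 2) • B9Eq37Insertion.imC (B9Eq39Adjoint.plaqU T U κ ν y) := by
    funext κ ν y
    rw [Pi.star_apply, Pi.star_apply, Pi.star_apply, star_smul, B9Eq310Hermitian.star_eta_sq,
      B9Eq37Insertion.star_imC (B9Eq310Hermitian.plaqU_unitary T U hU κ ν y)]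
  rw [B9Eq39Adjoint.J, B9Eq39Adjoint.divPη, star_smul, B9Eq310Hermitian.star_eta_inv, B9Eq310Hermitian.star_divP T U hU, hF]

end StarCurrent

section StarY

variable {d ℓ : ℕ} {hd : 1 ≤ d + 1} {hL : Odd (ℓ + 1) ∧ 1 < ℓ + 1} {b₀ b₁ : ℝ}
variable {𝔸 : Type} [NormedRing 𝔸] [NormedAlgebra ℂ 𝔸] [CompleteSpace 𝔸] [StarRing 𝔸] [StarModule ℂ 𝔸]

omit [CompleteSpace 𝔸] [StarModule ℂ 𝔸] in
/-- the pairing under `⋆` for a `⋆`-compatible `τ` (`τ(a⋆) = τ(a)⋆`): `⟨Ψ⋆, Φ⋆⟩_τ = ⟨Φ, Ψ⟩_τ⋆`. [cite: Balaban1985BackgroundPropagators, (3.11) p.392, bookkeeping] -/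
theorem trPairY_star {X : Type} [Fintype X] (τ : 𝔸 →ₗ[ℂ] ℂ) (hτ : ∀ a : 𝔸, τ (star a) = star (τ a)) (Φ Ψ : X → 𝔸) :
    trPairY τ (star Ψ) (star Φ) = star (trPairY τ Φ Ψ) := by
  simp only [trPairY, star_sum, ← hτ, star_mul, Pi.star_apply]

variable (i : KIdx d ℓ hd hL b₀ b₁)

/-- ★ **`J(U)⋆ = J(U)` ON NODE 00's CARRIERS** at a unitary background. [cite: Balaban1985BackgroundPropagators, (3.11) p.392, (3.117) p.419] -/
theorem star_JY {U : CfgY 𝔸 i} (hU : ∀ μ y, star ((U μ y : 𝔸ˣ) : 𝔸) = (((U μ y)⁻¹ : 𝔸ˣ) : 𝔸)) : star (JY i U) = JY i U :=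
  funext fun b => star_J (shiftsV1 (PV d ℓ i.m i.K hd hL)) U (fun μ y => (hU μ y).symm) (etaBY i) b.dir b.src

omit [StarModule ℂ 𝔸] in
/-- the unitary-units form of the letter `hU`: a `unitaryUnits`-valued background has `U(b)⋆ = U(b)⁻¹` (NE9's
`B9Eq326OperatorTowerRealityUnitary.star_val_eq_inv_of_mem_unitaryUnits` at NODE 00's configurations; that module is outside this file's import
closure, so the three-line proof is repeated rather than the tower imported). [cite: Balaban1985BackgroundPropagators, p.396 («values in G»), bookkeeping] -/
theorem star_eq_inv_of_mem_unitaryUnits {U : CfgY 𝔸 i} (hU : ∀ μ y, U μ y ∈ B7Prop2Explicit.unitaryUnits 𝔸) (μ : Fin (d + 1))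
    (y : Site (PV d ℓ i.m i.K hd hL) 0) : star ((U μ y : 𝔸ˣ) : 𝔸) = (((U μ y)⁻¹ : 𝔸ˣ) : 𝔸) := by
  have hu : ((U μ y : 𝔸ˣ) : 𝔸) ∈ unitary 𝔸 := (B7Prop2Explicit.mem_unitaryUnits).1 (hU μ y)
  calc star ((U μ y : 𝔸ˣ) : 𝔸) = (((U μ y)⁻¹ : 𝔸ˣ) : 𝔸) * (((U μ y : 𝔸ˣ) : 𝔸) * star ((U μ y : 𝔸ˣ) : 𝔸)) := by
        rw [← mul_assoc, Units.inv_mul, one_mul]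
    _ = (((U μ y)⁻¹ : 𝔸ˣ) : 𝔸) := by rw [Unitary.mul_star_self_of_mem hu, mul_one]

variable (𝔡 : TrDualY 𝔸) (parS : SiteParY 𝔸 i) (parB : BondParY 𝔸 i) (Gp : SiteOpY 𝔸 i)
variable (C : CfgY 𝔸 i → (FBondY i → 𝔸) →ₗ[ℂ] (FBondY i → 𝔸) →ₗ[ℂ] (IBondY i → 𝔸))

omit [StarModule ℂ 𝔸] in
/-- ★★ **`Δ⁽²⁾(U)` IS REAL FOR REAL LETTERS**: if `C⁽²⁾(U; A⋆, A′⋆) = C⁽²⁾(U; A, A′)⋆`, `H(U)X⋆ = (H(U)X)⋆` and `J(U)⋆ = J(U)` (a theorem at unitary `U`,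
`star_JY`), then `Δ⁽²⁾(U)A⋆ = (Δ⁽²⁾(U)A)⋆` (for a `⋆`-compatible tracial `τ`). [cite: Balaban1985BackgroundPropagators, (3.134) p.422, (3.11) p.392] -/
theorem delta2OfY_star (hτ : ∀ a : 𝔸, 𝔡.τ (star a) = star (𝔡.τ a)) (U : CfgY 𝔸 i)
    (hC : ∀ A A' : FBondY i → 𝔸, C U (star A) (star A') = star (C U A A'))
    (hH : ∀ X : IBondY i → 𝔸, HDY i parS parB Gp U (star X) = star (HDY i parS parB Gp U X)) (hJ : star (JY i U) = JY i U)
    (A : FBondY i → 𝔸) :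
    delta2OfY 𝔡 i parS parB Gp C U (star A) = star (delta2OfY 𝔡 i parS parB Gp C U A) := by
  refine trPairY_left_ext 𝔡 fun Φ => ?_
  have hC' : C U (star A) Φ = star (C U A (star Φ)) := by simpa only [star_star] using hC A (star Φ)
  have h2 : star (2 : ℂ) = 2 := star_ofNat 2
  have hL : trPairY 𝔡.τ Φ (delta2OfY 𝔡 i parS parB Gp C U (star A)) =
      2 * star (trPairY 𝔡.τ (HDY i parS parB Gp U (C U A (star Φ))) (JY i U)) := by
    rw [trPairY_delta2OfY, hC', hH]
    congr 1
    calc trPairY 𝔡.τ (star (HDY i parS parB Gp U (C U A (star Φ)))) (JY i U)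
          = trPairY 𝔡.τ (star (HDY i parS parB Gp U (C U A (star Φ)))) (star (JY i U)) := by rw [hJ]
      _ = star (trPairY 𝔡.τ (JY i U) (HDY i parS parB Gp U (C U A (star Φ)))) := trPairY_star 𝔡.τ hτ _ _
      _ = star (trPairY 𝔡.τ (HDY i parS parB Gp U (C U A (star Φ))) (JY i U)) := by rw [trPairY_comm 𝔡.τ 𝔡.τ_comm]
  have hR : trPairY 𝔡.τ Φ (star (delta2OfY 𝔡 i parS parB Gp C U A)) =
      2 * star (trPairY 𝔡.τ (HDY i parS parB Gp U (C U A (star Φ))) (JY i U)) := by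
    calc trPairY 𝔡.τ Φ (star (delta2OfY 𝔡 i parS parB Gp C U A))
          = trPairY 𝔡.τ (star (star Φ)) (star (delta2OfY 𝔡 i parS parB Gp C U A)) := by rw [star_star]
      _ = star (trPairY 𝔡.τ (delta2OfY 𝔡 i parS parB Gp C U A) (star Φ)) := trPairY_star 𝔡.τ hτ _ _
      _ = star (trPairY 𝔡.τ (star Φ) (delta2OfY 𝔡 i parS parB Gp C U A)) := by rw [trPairY_comm 𝔡.τ 𝔡.τ_comm]
      _ = 2 * star (trPairY 𝔡.τ (HDY i parS parB Gp U (C U A (star Φ))) (JY i U)) := by rw [trPairY_delta2OfY, star_mul, h2, mul_comm]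
  rw [hL, hR]

/-- ★★ reality of `Δ⁽²⁾(U)` at a UNITARY background from reality of `C⁽²⁾(U)` and `H(U)` alone (`J(U)⋆ = J(U)` discharged by `star_JY`).
[cite: Balaban1985BackgroundPropagators, (3.134) p.422, (3.11) p.392, p.396 («values in G»)] -/
theorem delta2OfY_star_of_unitary (hτ : ∀ a : 𝔸, 𝔡.τ (star a) = star (𝔡.τ a)) {U : CfgY 𝔸 i}
    (hU : ∀ μ y, star ((U μ y : 𝔸ˣ) : 𝔸) = (((U μ y)⁻¹ : 𝔸ˣ) : 𝔸))
    (hC : ∀ A A' : FBondY i → 𝔸, C U (star A) (star A') = star (C U A A'))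
    (hH : ∀ X : IBondY i → 𝔸, HDY i parS parB Gp U (star X) = star (HDY i parS parB Gp U X)) (A : FBondY i → 𝔸) :
    delta2OfY 𝔡 i parS parB Gp C U (star A) = star (delta2OfY 𝔡 i parS parB Gp C U A) :=
  delta2OfY_star i 𝔡 parS parB Gp C hτ U hC hH (star_JY i hU) A

end StarY

section StarRecord

variable {N : ℕ} (θ : Stage3Params) (Mstar : ℕ) (𝔠 : C2Y N θ Mstar)

/-- the matrix trace is `⋆`-compatible: `tr(a⋆) = (tr a)⋆`. [cite: Balaban1985BackgroundPropagators, (3.11) p.392, bookkeeping] -/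
theorem trDualMatY_τ_star (a : Matrix (Fin N) (Fin N) ℂ) : (trDualMatY N).τ (star a) = star ((trDualMatY N).τ a) := by
  rw [trDualMatY_τ, trDualMatY_τ, Matrix.star_eq_conjTranspose, Matrix.trace_conjTranspose]

/-- ★★ **THE RECORD's `Δ⁽²⁾(U)` IS REAL at a unitary-valued `U` for real `C⁽²⁾(U)`, `H(U)`**. [cite: Balaban1985BackgroundPropagators, (3.134) p.422, p.396 («values in G»)] -/
theorem resYOfC2_Δ2_star (x : MemberY θ.d₆ θ.ℓ₆ θ.hd' θ.hL' θ.b₀ θ.b₁ Mstar) {U : CfgY (Matrix (Fin N) (Fin N) ℂ) x.toKIdx}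
    (hU : ∀ μ y, U μ y ∈ B7Prop2Explicit.unitaryUnits (Matrix (Fin N) (Fin N) ℂ))
    (hC : ∀ A A' : FBondY x.toKIdx → Matrix (Fin N) (Fin N) ℂ, (𝔠 x).form U (star A) (star A') = star ((𝔠 x).form U A A'))
    (hH : ∀ X : IBondY x.toKIdx → Matrix (Fin N) (Fin N) ℂ,
      HDY x.toKIdx (parSymY x.toKIdx) (parBY x.toKIdx) (GpY x.toKIdx (parSymY x.toKIdx)) U (star X) =
        star (HDY x.toKIdx (parSymY x.toKIdx) (parBY x.toKIdx) (GpY x.toKIdx (parSymY x.toKIdx)) U X))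
    (A : FBondY x.toKIdx → Matrix (Fin N) (Fin N) ℂ) :
    (resYOfC2 N θ Mstar 𝔠 x).Δ2 U (star A) = star ((resYOfC2 N θ Mstar 𝔠 x).Δ2 U A) :=
  delta2OfY_star_of_unitary x.toKIdx (trDualMatY N) _ _ _ _ trDualMatY_τ_star (star_eq_inv_of_mem_unitaryUnits x.toKIdx hU) hC hH A

/-- ★★★ **THE CONSUMER HYPOTHESIS `hΔ2` OF `Node00.OpsYSectDESymm` DISCHARGED FOR `𝔯 := resYOfC2 𝔠`** at a unitary-valued background, modulo the
displayed reality of the letters `C⁽²⁾(U)` and `H(U)`: the record's `Δ⁽²⁾(U)` is symmetric in def-Y's Hermitian currency (`IsSymmTr 1`), so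
`G₁_isSymmTr_ofRecordV4` ∕ `GG_isSymmTr_ofRecordV4` ∕ `covLettersY_v4_QG1Qinv_isSymmTr` apply. [cite: Balaban1985BackgroundPropagators, (3.134) p.422, Thm 3.11 p.416, (3.153) p.426] -/
theorem resYOfC2_Δ2_isSymmTr (x : MemberY θ.d₆ θ.ℓ₆ θ.hd' θ.hL' θ.b₀ θ.b₁ Mstar) {U : CfgY (Matrix (Fin N) (Fin N) ℂ) x.toKIdx}
    (hU : ∀ μ y, U μ y ∈ B7Prop2Explicit.unitaryUnits (Matrix (Fin N) (Fin N) ℂ))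
    (hC : ∀ A A' : FBondY x.toKIdx → Matrix (Fin N) (Fin N) ℂ, (𝔠 x).form U (star A) (star A') = star ((𝔠 x).form U A A'))
    (hH : ∀ X : IBondY x.toKIdx → Matrix (Fin N) (Fin N) ℂ,
      HDY x.toKIdx (parSymY x.toKIdx) (parBY x.toKIdx) (GpY x.toKIdx (parSymY x.toKIdx)) U (star X) =
        star (HDY x.toKIdx (parSymY x.toKIdx) (parBY x.toKIdx) (GpY x.toKIdx (parSymY x.toKIdx)) U X)) :
    IsSymmTr (fun _ => (1 : ℝ)) ((resYOfC2 N θ Mstar 𝔠 x).Δ2 U) :=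
  resYOfC2_Δ2_isSymmTr_of_star θ Mstar 𝔠 x U (resYOfC2_Δ2_star θ Mstar 𝔠 x hU hC hH)

end StarRecord

/-! ## §7 ★★★ Edition 8's `hsymD` at the v4 record over `𝔯 := resYOfC2 𝔠` — from reality of the letters `C⁽²⁾`, `H` alone -/

section RecordSymm

open B7Prop2SpecialUnitary (specialUnitaryUnits specialUnitaryUnits_le_unitaryUnits)

variable {N : ℕ} (θ : Stage3Params) (Mstar : ℕ) (𝔠 : C2Y N θ Mstar)

/-- ★★★ **THE N06 CERTIFICATE's LETTER-SYMMETRY BINDER `hsymD` (`GD ∧ G₁ ∧ GG` at special-unitary configurations) AT THE RECORD OVER THE RESIDUAL FAMILY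
`resYOfC2 𝔠`** — gen 8's `lettersYOfRecordV4_symmDG₁GG` with its displayed `hΔ2` DISCHARGED by `resYOfC2_Δ2_isSymmTr`; what stays displayed is the
reality of the two letters `C⁽²⁾(U)` ([5]'s, a parameter) and `H(U)` (def-Y's (3.126); its reality calculus is not in the tree) at `SU(N)`-valued `U`.
[cite: Balaban1985BackgroundPropagators, (3.122) p.420, (3.128) p.421, (3.134) p.422, (3.153) p.426, (3.35) p.396] -/
theorem lettersYOfRecordV4_symmDG₁GG_ofC2
    (hC : ∀ (x : MemberY θ.d₆ θ.ℓ₆ θ.hd' θ.hL' θ.b₀ θ.b₁ Mstar) (U : CfgY (Matrix (Fin N) (Fin N) ℂ) x.toKIdx), (∀ μ z, U μ z ∈ specialUnitaryUnits (Fin N)) →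
      ∀ A A' : FBondY x.toKIdx → Matrix (Fin N) (Fin N) ℂ, (𝔠 x).form U (star A) (star A') = star ((𝔠 x).form U A A'))
    (hH : ∀ (x : MemberY θ.d₆ θ.ℓ₆ θ.hd' θ.hL' θ.b₀ θ.b₁ Mstar) (U : CfgY (Matrix (Fin N) (Fin N) ℂ) x.toKIdx), (∀ μ z, U μ z ∈ specialUnitaryUnits (Fin N)) →
      ∀ X : IBondY x.toKIdx → Matrix (Fin N) (Fin N) ℂ,
        HDY x.toKIdx (parSymY x.toKIdx) (parBY x.toKIdx) (GpY x.toKIdx (parSymY x.toKIdx)) U (star X) =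
          star (HDY x.toKIdx (parSymY x.toKIdx) (parBY x.toKIdx) (GpY x.toKIdx (parSymY x.toKIdx)) U X)) :
    ∀ (x : MemberY θ.d₆ θ.ℓ₆ θ.hd' θ.hL' θ.b₀ θ.b₁ Mstar) (U : CfgY (Matrix (Fin N) (Fin N) ℂ) x.toKIdx), (∀ μ z, U μ z ∈ specialUnitaryUnits (Fin N)) →
      IsSymmTr (fun _ => (1 : ℝ)) ((lettersYOfRecordV4 N θ Mstar (resYOfC2 N θ Mstar 𝔠) x).GD U) ∧
        IsSymmTr (fun _ => (1 : ℝ)) ((lettersYOfRecordV4 N θ Mstar (resYOfC2 N θ Mstar 𝔠) x).G₁ U) ∧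
          IsSymmTr (fun _ => (1 : ℝ)) ((lettersYOfRecordV4 N θ Mstar (resYOfC2 N θ Mstar 𝔠) x).GG U) :=
  lettersYOfRecordV4_symmDG₁GG θ Mstar (resYOfC2 N θ Mstar 𝔠) fun x U hU =>
    resYOfC2_Δ2_isSymmTr θ Mstar 𝔠 x (fun μ z => specialUnitaryUnits_le_unitaryUnits (hU μ z)) (hC x U hU) (hH x U hU)

/-- the v7 instance's base letters ARE the v4 letters over `resYOfC2 𝔠` (so §7 applies to `opsYOfRecordV7E` through `opsYOfRecordV4E_letters`).
[cite: Balaban1985BackgroundPropagators, Thms 3.1–3.14 pp.397–427, bookkeeping] -/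
theorem opsYOfRecordV7E_letters (𝔢₀ : SectEY N θ Mstar) (𝔴 : RWEY N θ Mstar) (𝔈 : ExpsY N θ Mstar) (x : MemberY θ.d₆ θ.ℓ₆ θ.hd' θ.hL' θ.b₀ θ.b₁ Mstar) :
    (opsYOfRecordV7E N θ Mstar 𝔠 𝔢₀ 𝔴 𝔈 x).P349 = (opsYOfRecordV4E N θ Mstar (resYOfC2 N θ Mstar 𝔠) 𝔢₀ 𝔴 𝔈 x).P349 ∧
      (opsYOfRecordV7E N θ Mstar 𝔠 𝔢₀ 𝔴 𝔈 x).HasRWExpC = (opsYOfRecordV4E N θ Mstar (resYOfC2 N θ Mstar 𝔠) 𝔢₀ 𝔴 𝔈 x).HasRWExpC :=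
  opsYOfRecordV6E_letters N θ Mstar (resYOfC2 N θ Mstar 𝔠) 𝔢₀ 𝔴 𝔈 x

end RecordSymm

/-! ## §8 Gauge covariance of `Δ⁽²⁾(U)` (3.34): `Δ⁽²⁾(U^u)R(u) = R(u)Δ⁽²⁾(U)` — from `J^u = R(u)J` (3.30, proved) and the covariance of `H`, `C⁽²⁾` -/

section Cov

open B9Eq39Adjoint (R R_mul_R)

variable {𝔸 : Type} [NormedRing 𝔸] [NormedAlgebra ℂ 𝔸] [CompleteSpace 𝔸]
variable (𝔡 : TrDualY 𝔸) {X Y : Type} [Fintype X] [Fintype Y]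

omit [CompleteSpace 𝔸] in
/-- a tracial `τ` is conjugation invariant: `τ(u a u⁻¹) = τ(a)`. [cite: Balaban1985BackgroundPropagators, (3.28) p.395, bookkeeping] -/
theorem TrDualY.τ_R (u : 𝔸ˣ) (a : 𝔸) : 𝔡.τ (R u a) = 𝔡.τ a := by
  rw [R, 𝔡.τ_comm, ← mul_assoc, Units.inv_mul, one_mul]

omit [CompleteSpace 𝔸] in
/-- the trace pairing is `R(u)`-invariant: `⟨R(u)Φ, R(u)Ψ⟩_τ = ⟨Φ, Ψ⟩_τ`. [cite: Balaban1985BackgroundPropagators, (3.30) p.395 («⟨R(u)A, J^u⟩ = ⟨A, J⟩» shape), bookkeeping] -/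
theorem trPairY_conjY (γ : X → 𝔸ˣ) (Φ Ψ : X → 𝔸) : trPairY 𝔡.τ (conjY γ Φ) (conjY γ Ψ) = trPairY 𝔡.τ Φ Ψ := by
  simp only [trPairY_def, conjY_apply, R_mul_R, TrDualY.τ_R]

omit [Fintype X] [CompleteSpace 𝔸] in
/-- `R(u)R(u⁻¹) = 1`, applied. [cite: Balaban1985BackgroundPropagators, (3.31) p.395, bookkeeping] -/
theorem conjY_conjY_inv (γ : X → 𝔸ˣ) (Ψ : X → 𝔸) : conjY γ (conjY γ⁻¹ Ψ) = Ψ := by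
  rw [← LinearMap.comp_apply, ← conjY_mul, mul_inv_cancel, conjY_one, LinearMap.id_apply]

omit [CompleteSpace 𝔸] in
/-- moving `R(u)` across the pairing: `⟨R(u)Φ, Ψ⟩_τ = ⟨Φ, R(u⁻¹)Ψ⟩_τ`. [cite: Balaban1985BackgroundPropagators, (3.30) p.395, bookkeeping] -/
theorem trPairY_conjY_left (γ : X → 𝔸ˣ) (Φ Ψ : X → 𝔸) : trPairY 𝔡.τ (conjY γ Φ) Ψ = trPairY 𝔡.τ Φ (conjY γ⁻¹ Ψ) := by
  conv_lhs => rw [← conjY_conjY_inv γ Ψ]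
  exact trPairY_conjY 𝔡 γ Φ _

omit [CompleteSpace 𝔸] in
/-- ★ the dualising map is `R(u)`-EQUIVARIANT: `R(u) ρ_X(F ∘ R(u)) = ρ_X(F)`. [cite: Balaban1985BackgroundPropagators, (3.134) p.422, (3.28) p.395, bookkeeping] -/
theorem conjY_rieszY_comp_conjY (γ : X → 𝔸ˣ) (F : (X → 𝔸) →ₗ[ℂ] ℂ) : conjY γ (rieszY 𝔡 (F ∘ₗ conjY γ)) = rieszY 𝔡 F := by
  refine trPairY_left_ext 𝔡 fun Φ => ?_
  calc trPairY 𝔡.τ Φ (conjY γ (rieszY 𝔡 (F ∘ₗ conjY γ)))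
      = trPairY 𝔡.τ (conjY γ (conjY γ⁻¹ Φ)) (conjY γ (rieszY 𝔡 (F ∘ₗ conjY γ))) := by rw [conjY_conjY_inv]
    _ = trPairY 𝔡.τ (conjY γ⁻¹ Φ) (rieszY 𝔡 (F ∘ₗ conjY γ)) := trPairY_conjY 𝔡 γ _ _
    _ = F Φ := by rw [trPairY_rieszY, LinearMap.comp_apply, conjY_conjY_inv]
    _ = trPairY 𝔡.τ Φ (rieszY 𝔡 F) := (trPairY_rieszY 𝔡 F Φ).symm

variable {d ℓ : ℕ} {hd : 1 ≤ d + 1} {hL : Odd (ℓ + 1) ∧ 1 < ℓ + 1} {b₀ b₁ : ℝ}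
variable (i : KIdx d ℓ hd hL b₀ b₁)

omit [Fintype X] [Fintype Y] in
/-- def-Y's `U^u` (3.28) on NODE 00's backgrounds IS r06's `gaugeTr` on the torus model `(Site, shiftsV1, Fin (d+1))`.
[cite: Balaban1985BackgroundPropagators, (3.28) p.395, dictionary] -/
theorem gaugeY_eq_gaugeTr (g : GaugeY 𝔸 i) (U : CfgY 𝔸 i) :
    gaugeY i g U = B9Eq3117Current.gaugeTr (shiftsV1 (PV d ℓ i.m i.K hd hL)) g U := rfl

omit [Fintype X] [Fintype Y] in
/-- ★ **(3.30) `J^u = R(u)J` AT NODE 00**: `J(U^u)(b) = R(u(b₋))J(U)(b)` — r06's `B9Eq3117Current.J_gaugeTr` BY NAME.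
[cite: Balaban1985BackgroundPropagators, (3.30) p.395] -/
theorem JY_gaugeY (g : GaugeY 𝔸 i) (U : CfgY 𝔸 i) : JY i (gaugeY i g U) = conjY (gBondY i g) (JY i U) := by
  funext b
  rw [JY_apply, gaugeY_eq_gaugeTr, B9Eq3117Current.J_gaugeTr _ _ (shiftsV1_comm i) g (etaBY i) b.dir b.src]
  rfl

variable (parS : SiteParY 𝔸 i) (parB : BondParY 𝔸 i) (Gp : SiteOpY 𝔸 i)
variable (C : CfgY 𝔸 i → (FBondY i → 𝔸) →ₗ[ℂ] (FBondY i → 𝔸) →ₗ[ℂ] (IBondY i → 𝔸))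

omit [Fintype X] [Fintype Y] in
/-- ★★ **`Δ⁽²⁾(U^u)R(u) = R(u)Δ⁽²⁾(U)`** — (3.34)'s covariance for the residual letter of (3.134), at ANY tables, from the covariance of `H` (displayed:
`H(U^u)R(u) = R(u)H(U)` from coarse bonds to bonds) and of the form `C⁽²⁾` (displayed: `C⁽²⁾(U^u; R(u)A, R(u)A′) = R(u)C⁽²⁾(U; A, A′)`); `J^u = R(u)J`
is PROVED (`JY_gaugeY`) and the pairing is `R(u)`-invariant. [cite: Balaban1985BackgroundPropagators, (3.134) p.422, (3.34) p.396, (3.30) p.395] -/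
theorem delta2OfY_cov (g : GaugeY 𝔸 i) (U : CfgY 𝔸 i)
    (hH : Intw (conjY (gIBondY i g)) (conjY (gBondY i g)) (HDY i parS parB Gp U) (HDY i parS parB Gp (gaugeY i g U)))
    (hC : ∀ A A' : FBondY i → 𝔸, C (gaugeY i g U) (conjY (gBondY i g) A) (conjY (gBondY i g) A') = conjY (gIBondY i g) (C U A A')) :
    Intw (conjY (gBondY i g)) (conjY (gBondY i g)) (delta2OfY 𝔡 i parS parB Gp C U) (delta2OfY 𝔡 i parS parB Gp C (gaugeY i g U)) := by
  refine LinearMap.ext fun A => ?_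
  rw [LinearMap.comp_apply, LinearMap.comp_apply]
  refine trPairY_left_ext 𝔡 fun A' => ?_
  conv_lhs => rw [← conjY_conjY_inv (gBondY i g) A']
  conv_rhs => rw [← conjY_conjY_inv (gBondY i g) A']
  rw [trPairY_delta2OfY, hC, hH.apply, JY_gaugeY, trPairY_conjY, trPairY_conjY, trPairY_delta2OfY]

omit [Fintype X] [Fintype Y] in
/-- the packaged form: a covariant `H` and a covariant form `C⁽²⁾` give a COVARIANT residual letter `Δ⁽²⁾ := delta2OfY …` (`IsCovBondOpY`).
[cite: Balaban1985BackgroundPropagators, (3.134) p.422, (3.34) p.396] -/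
theorem delta2OfY_isCovBondOpY
    (hH : ∀ (g : GaugeY 𝔸 i) (U : CfgY 𝔸 i), Intw (conjY (gIBondY i g)) (conjY (gBondY i g)) (HDY i parS parB Gp U) (HDY i parS parB Gp (gaugeY i g U)))
    (hC : ∀ (g : GaugeY 𝔸 i) (U : CfgY 𝔸 i) (A A' : FBondY i → 𝔸),
      C (gaugeY i g U) (conjY (gBondY i g) A) (conjY (gBondY i g) A') = conjY (gIBondY i g) (C U A A')) :
    IsCovBondOpY i (delta2OfY 𝔡 i parS parB Gp C) := fun g U => delta2OfY_cov 𝔡 i parS parB Gp C g U (hH g U) (hC g U)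

end Cov

/-! ## §9 At the record: `resYOfC2 𝔠` is a COVARIANT residual family for a covariant `C⁽²⁾` — `lettersYOfRecordV4_cov`'s displayed `hΔ` discharged -/

section RecordCov

variable {𝔸 : Type} [NormedRing 𝔸] [NormedAlgebra ℂ 𝔸] [CompleteSpace 𝔸] (𝔡 : TrDualY 𝔸)
variable {d ℓ : ℕ} {hd : 1 ≤ d + 1} {hL : Odd (ℓ + 1) ∧ 1 < ℓ + 1} {b₀ b₁ : ℝ} {Mstar : ℕ}

/-- **COVARIANCE OF THE FORM LETTER** `C⁽²⁾` at a member (displayed letter property; print: the averaging operations and their Taylor terms are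
covariant, [5] (52) p.26). [cite: Balaban1985BackgroundPropagators, (3.33)–(3.34) p.396; Balaban1985Averaging, (52) p.26] -/
def C2LettersY.IsCov {x : KIdx d ℓ hd hL b₀ b₁} (𝔠 : C2LettersY 𝔸 x) : Prop :=
  ∀ (g : GaugeY 𝔸 x) (U : CfgY 𝔸 x) (A A' : FBondY x → 𝔸),
    𝔠.form (gaugeY x g U) (conjY (gBondY x g) A) (conjY (gBondY x g) A') = conjY (gIBondY x g) (𝔠.form U A A')

/-- the flat form letter is covariant. [cite: Balaban1985BackgroundPropagators, (3.34) p.396, bookkeeping] -/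
theorem c2LettersY_flat_isCov (x : KIdx d ℓ hd hL b₀ b₁) : (c2LettersY_flat 𝔸 x).IsCov := fun g U A A' => by
  simp only [c2LettersY_flat_form, LinearMap.zero_apply, map_zero]

/-- ★★ **`(res134OfC2Y 𝔡 x 𝔠).Δ2` IS COVARIANT** for a covariant form letter — `H`'s covariance at def-Y's tables of record is def-Y's `HDY_cov`
(over `parSymY_isGaugeLawS`, `parBY_isGaugeLawB`, `GpY_isCovSiteOpY`). [cite: Balaban1985BackgroundPropagators, (3.134) p.422, (3.34) p.396, (3.126) p.420] -/
theorem res134OfC2Y_Δ2_isCovBondOpY (x : MemberY d ℓ hd hL b₀ b₁ Mstar) (𝔠 : C2LettersY 𝔸 x.toKIdx) (hC : 𝔠.IsCov) :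
    IsCovBondOpY x.toKIdx (res134OfC2Y 𝔡 x 𝔠).Δ2 := by
  have hS := parSymY_isGaugeLawS (𝔸 := 𝔸) x.toKIdx
  have hB := parBY_isGaugeLawB (𝔸 := 𝔸) x.toKIdx
  have hGp := GpY_isCovSiteOpY hS
  rw [res134OfC2Y_Δ2]
  exact delta2OfY_isCovBondOpY 𝔡 x.toKIdx _ _ _ 𝔠.form (fun g U => HDY_cov hS hB hGp) hC

variable {N : ℕ} (θ : Stage3Params) (Mstar' : ℕ)

/-- covariance of the family of form letters, member by member. [cite: Balaban1985BackgroundPropagators, (3.34) p.396, bookkeeping] -/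
def C2Y.IsCov (𝔠 : C2Y N θ Mstar') : Prop := ∀ x, (𝔠 x).IsCov

/-- the flat family is covariant. [cite: Balaban1985BackgroundPropagators, (3.34) p.396, bookkeeping] -/
theorem c2Y_flat_isCov : (c2Y_flat N θ Mstar').IsCov := fun x => c2LettersY_flat_isCov x.toKIdx

/-- ★★ `resYOfC2 𝔠` is a covariant residual family for a covariant `𝔠`. [cite: Balaban1985BackgroundPropagators, (3.134) p.422, (3.34) p.396] -/
theorem resYOfC2_Δ2_isCovBondOpY (𝔠 : C2Y N θ Mstar') (hC : 𝔠.IsCov) (x : MemberY θ.d₆ θ.ℓ₆ θ.hd' θ.hL' θ.b₀ θ.b₁ Mstar') :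
    IsCovBondOpY x.toKIdx ((resYOfC2 N θ Mstar' 𝔠 x).Δ2) :=
  res134OfC2Y_Δ2_isCovBondOpY (trDualMatY N) x (𝔠 x) (hC x)

/-- ★★★ **THE v4 LETTERS OF RECORD OVER `𝔯 := resYOfC2 𝔠` ARE GAUGE COVARIANT** — def-Y's `lettersYOfRecordV4_cov` with its displayed `hΔ` DISCHARGED
for a covariant form letter `𝔠`. [cite: Balaban1985BackgroundPropagators, (3.33)–(3.34) p.396, (3.119)–(3.153) pp.419–426, Thm 3.14 pp.426–427] -/
theorem lettersYOfRecordV4_cov_ofC2 (𝔠 : C2Y N θ Mstar') (hC : 𝔠.IsCov) (x : MemberY θ.d₆ θ.ℓ₆ θ.hd' θ.hL' θ.b₀ θ.b₁ Mstar')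
    (g : GaugeY (Matrix (Fin N) (Fin N) ℂ) x.toKIdx) (U : CfgY (Matrix (Fin N) (Fin N) ℂ) x.toKIdx) :
    Intw (conjY (gBondY x.toKIdx g)) (conjY (gBondY x.toKIdx g)) ((lettersYOfRecordV4 N θ Mstar' (resYOfC2 N θ Mstar' 𝔠) x).GD U)
        ((lettersYOfRecordV4 N θ Mstar' (resYOfC2 N θ Mstar' 𝔠) x).GD (gaugeY x.toKIdx g U)) ∧
      Intw (conjY (gBondY x.toKIdx g)) (conjY (gBondY x.toKIdx g)) ((lettersYOfRecordV4 N θ Mstar' (resYOfC2 N θ Mstar' 𝔠) x).G₁ U)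
        ((lettersYOfRecordV4 N θ Mstar' (resYOfC2 N θ Mstar' 𝔠) x).G₁ (gaugeY x.toKIdx g U)) ∧
      Intw (conjY (gBondY x.toKIdx g)) (conjY (gBondY x.toKIdx g)) ((lettersYOfRecordV4 N θ Mstar' (resYOfC2 N θ Mstar' 𝔠) x).GG U)
        ((lettersYOfRecordV4 N θ Mstar' (resYOfC2 N θ Mstar' 𝔠) x).GG (gaugeY x.toKIdx g U)) ∧
      Intw (conjY (gBondY x.toKIdx g)) (conjY (gBondY x.toKIdx g)) ((lettersYOfRecordV4 N θ Mstar' (resYOfC2 N θ Mstar' 𝔠) x).Kdiff U)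
        ((lettersYOfRecordV4 N θ Mstar' (resYOfC2 N θ Mstar' 𝔠) x).Kdiff (gaugeY x.toKIdx g U)) ∧
      Intw (conjY (gIBondY x.toKIdx g)) (conjY (gBondY x.toKIdx g)) ((lettersYOfRecordV4 N θ Mstar' (resYOfC2 N θ Mstar' 𝔠) x).H U)
        ((lettersYOfRecordV4 N θ Mstar' (resYOfC2 N θ Mstar' 𝔠) x).H (gaugeY x.toKIdx g U)) ∧
      Intw (conjY (gIBondY x.toKIdx g)) (conjY (gBondY x.toKIdx g)) ((lettersYOfRecordV4 N θ Mstar' (resYOfC2 N θ Mstar' 𝔠) x).H₁ U)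
        ((lettersYOfRecordV4 N θ Mstar' (resYOfC2 N θ Mstar' 𝔠) x).H₁ (gaugeY x.toKIdx g U)) ∧
      Intw (conjY (gIBondY x.toKIdx g)) (conjY (gIBondY x.toKIdx g)) ((lettersYOfRecordV4 N θ Mstar' (resYOfC2 N θ Mstar' 𝔠) x).QGQinv U)
        ((lettersYOfRecordV4 N θ Mstar' (resYOfC2 N θ Mstar' 𝔠) x).QGQinv (gaugeY x.toKIdx g U)) ∧
      Intw (conjY (gIBondY x.toKIdx g)) (conjY (gIBondY x.toKIdx g)) ((lettersYOfRecordV4 N θ Mstar' (resYOfC2 N θ Mstar' 𝔠) x).QG1Qinv U)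
        ((lettersYOfRecordV4 N θ Mstar' (resYOfC2 N θ Mstar' 𝔠) x).QG1Qinv (gaugeY x.toKIdx g U)) :=
  lettersYOfRecordV4_cov N θ Mstar' (resYOfC2 N θ Mstar' 𝔠) x (resYOfC2_Δ2_isCovBondOpY θ Mstar' 𝔠 hC x) g U

end RecordCov

end Literature.MathematicalPhysics.QuantumFieldTheory.Balaban1983to89.Node00

end
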